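import Literature.MathematicalPhysics.QuantumFieldTheory.Balaban1983to89.B12FormatPlus
import Literature.MathematicalPhysics.QuantumFieldTheory.Balaban1983to89.B13
import Literature.MathematicalPhysics.QuantumFieldTheory.Balaban1983to89.B13Term214
import Literature.MathematicalPhysics.QuantumFieldTheory.Balaban1983to89.Node00.BackgroundActionT
import Literature.MathematicalPhysics.QuantumFieldTheory.Balaban1983to89.B13Term214ParamHolo
import Literature.MathematicalPhysics.QuantumFieldTheory.Balaban1983to89.B13Lemma3TorusBindersHolo
import Literature.MathematicalPhysics.QuantumFieldTheory.Balaban1983to89.B13Resummation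
import Literature.MathematicalPhysics.QuantumFieldTheory.Balaban1983to89.B13LocEAnalytic

/-!
# LENS-2 (gen 6) — the ZERO-INPUT SPLIT priced IN KERNEL: (Z) and (L♭) are the tree's [II] chain at the two ends of a FORMAT WINDOW;
# CRIT-1's two named M-leaves — K6 (the deepest V-joint under the history multiplier) and the `z`-analyticity ("KP") leaf — as by-name
# instances of tree theorems; the CAP LETTERS, (2.38) and (I.1.18)-with-½Ē' at the cap as receipts (§8, editions 2–3); Sketch v8.2 (gen 5) carried verbatim as §§1–4

Unit `ymgap-nodeO-lens-2-g6` (LENS IDEATOR 2, lens (ii) «RG map as a flow on a space of formats»), crux K0⁷ `stmt-QuantumFields-20541`,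
target = record stub 2′ `K0V23Defs.stub_absBetaBoxAtThm1WitnessCCMGenGridGZB13` via the wall item 27930⁗ (`FP.FormatPlusG` of the record's
pieces) and its filed [support] sub-target `stmt-QuantumFields-26648` `PortZeroInputSplitZD` (director №442 (i)): "(Z) zero-input format σ ∧
(L) history-channel contraction ρ·E under shared ∃(σ,ρ,Ē); (1.19) row via gaugeInv119_add", (L♭) fixed-scale Schwarz = its PROOF ROUTE.
CRIT-1 g32 (HOME STATUS l.3597): K1 KERNEL PASS · K2 PRINT PASS · (L♭) TAG = M · U-c PASSED; price of ZD = "{(Z) with its D = ∅ S/M variant,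
(L) via (L♭): K6 `h226_histMul` + KP-analyticity leaf}".  THIS GENERATION PAYS THAT PRICE DOWN IN KERNEL (new §§5–7, 0 sorry):

* §5 THE WINDOW.  Print fixes one format letter `E₀`; the tree's `B13.Consts` carries it as a field and EVERY joiner of the [II] chain is
  parametric in the record, so "(Z)'s variant" and "(L♭)'s scale" are the SAME chain at two records `c` (floor) and `withE₀ c Ē'` (cap) —
  no S/M variant of any theorem is needed.  The letters' `E₀`-scaling, proved: (2.18) is `E₀`-LINEAR (`invTau_eq`, `invTau_withE₀`: the
  τ-radii SHRINK by `E₀/Ē'` at the cap — the cap IS the joiners' binder `invTau ≤ ½`, `invTau_withE₀_le_half_iff`, and as ONE inequality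
  on `Ē'` uniform in the domain, `invTau_withE₀_le_half_of_cap`: `Ē'·ε₁C₁α₄⁻¹M^q e^{C₂κ₁} ≤ ½`); R12 is MONOTONE in the format
  (`R12_withE₀`; the floor is print's `E₀ ≥ C₃/C₁`, the clause that keeps (2.20) valid on the larger τ-circles); the (2.26)-weight at scale
  `E'` is `(E'/E₀)^{|𝐃|}` × the scale-`E₀` weight — ONE factor per HISTORY vertex (`weight_withE₀`); zero history (`z = 0`) meets Lemma 2's
  rows at EVERY scale (`lemma2Printed_zeroHistory`, `histMul_zero_Vpp`).
* §6 K6 IN KERNEL, BOTH EDGES.  `h226_holo_histMul` (cap edge): the tree's deepest V-consuming theorem — (2.26) for one term of (2.14)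
  from the primitive kernels + Lemma 2, holomorphy slots derived (`B13Lemma3TorusBindersHolo.h226_torus_of_primitives_of_lemma2_holo` ✓) —
  applied BY NAME to the multiplied two-torus record `twoTorusHistMul W z` at the cap record `withE₀ c Ē'`: Lemma 2's rows of the
  UNMULTIPLIED record at its OWN constants in, (2.26) for the term with potentials `V + (z−1)V_h` (`‖z‖·E₀ ≤ Ē'`) out, weight at scale `Ē'`;
  every kernel ∕ smallness ∕ volume letter UNCHANGED (they never mention `E₀`); exactly one binder moves: `|τ(Y)| ≥ 2` at the cap
  (`hhalf'`).  `h226_holo_zeroHistory` (floor edge = CRIT-1's "(Z) with its 𝐃 = ∅ variant"): the SAME tree theorem at `z = 0` and the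
  record's own constants, Lemma 2's (1.36) row DISCHARGED (`‖0·V″‖ = 0`) — potentials `V − V_h = V_q`, weight at the floor; no variant theorem.
* §7 THE `z`-ANALYTICITY CHAIN — BY NAME.  The tree already holds the generic-parameter holomorphy chain (L♭) needs, for a complex parameter
  entering only the potentials: term level `B13Term214ParamHolo` (★ `differentiableOn_term214_param_polyτ`, torus editions, and for the W1
  datum `B13TermDatum214ParamHolo.h226T_of_inputs226Holo`: holomorphy AND the (2.26) weight along ANY holomorphic history pencil `cv`, here
  `cv z := z • old`); output level `B13LocEAnalytic` (`B13Resummation.differentiableOn_locE_param_of_kp`: (2.13)'s `E(X)` holomorphic under a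
  parameter-UNIFORM [KP86] condition).  In kernel here, the two ends only: (a) `differentiableOn_core214_histMul` = ONE application of
  `B13Term214ParamHolo.differentiableOn_core214_lastLine` to `𝐕_z := V_q + z·V_h`; (d) `norm_locE_hist_sub_le` — SCHWARZ at (2.13):
  `‖E(X; z=1) − E(X; z=0)‖ ≤ 2N/R` from any `z`-uniform bound `N` on the disc of radius `R = Ē'/E > 1` (ONE application of `B13LocEAnalytic`
  + Mathlib's `Complex.dist_le_div_mul_dist_of_mapsTo_ball`); (d′) `hist_contraction_letter`: with `N = E₁e^{−κd(X)}` this is (L) with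
  `ρ = 2E₁/Ē'` (`Ē'`-free ratio by §1 `schwarzSlope_eq` = print's R23 letter).  Nothing in between is restated (typer lint: cite, do not twin).
  What is NOT in kernel (honest): the `z`-UNIFORM (2.38)-bound of the (2.11) ACTIVITIES `H(Z; z)` at the cap — i.e. feeding §6's per-term
  bound through the tree's record-parametric Mayer ∕ decoupling assembly (`B13Lemma3Assembly.bound238With_of_226` → `B13Resummation.kp_condition`)
  for the MULTIPLIED record, plus the KP smallness letter at the cap — bookkeeping over typed theorems, localised to ONE named passage; and the
  typer's identification of the abstract history channel with the record's `z·𝐄_k` pencil (wall item 27930⁗, unchanged).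
* §8 THE CAP LETTERS (edition 2).  Every smallness letter the [II] chain CONSUMES, read at the cap record, has the ONE shape
  `Ē'·(E₀-free) ≤ const` — τ-cap (§5), R15 (`R15_withE₀_iff`), R18half ∕ R18sharp (`R18half_withE₀_iff`, `R18sharp_withE₀_iff`), the
  [KP86] smallness of (2.12) (`kpSmall_withE₀_iff`); the C₃-absorption is SCALE-FREE (`absorbC3_iff`, `absorbC3_withE₀`), R17 MONOTONE
  (`eps2_withE₀_mono`), R23 scale-free (§1), R12 monotone (§5): the window's cap is `min_i const_i/slope_i` over PRINT'S OWN letters, no new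
  letter.  Receipt `bound238_cap_of_termwise`: (2.38) AT THE CAP for ANY two-torus record (in particular the history-multiplied one with
  its own output and terms) from termwise (2.26) at the cap (§6 per term) — the tree's `B13Lemma3TorusTerms.bound238_torus_of_226` read at
  `withE₀ c Ē'`, binders = its E₀-free letters verbatim + R17 at the floor + the scale-free absorption + exactly THREE cap inequalities.
  Second receipt `bound118_cap_of_termwise` (edition 3): ∘ `B13.bound238With_half` ∘ `B13Resummation.bound118_of_KP` at the cap —
  (I.1.18) with `½Ē'`, i.e. `|E^{(k+1)}(X)| ≤ ½Ē'e^{−κd(X)}` for ANY two-torus record from termwise (2.26) at the cap + the record's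
  polymer geometry `G`, restriction property `hsp`, representation (2.13) `hrep` (the tree's own §2-chain inputs) + R22, `hlarge`, `hA₂`
  verbatim + R23 SCALE-FREE (`R23_withE₀_iff`) + ONE more cap inequality (the [KP86] smallness).  This is the `N(X) = ½Ē'e^{−κd(X)}`
  that §7's Schwarz step consumes.  So the "remaining passage" of §7 is now: termwise domination `hH` (2.9)/(2.14), (2.13) `hrep`,
  p. 15 `hsp` and `G` for the multiplied record — reader-supplied exactly as the tree leaves them for the unmultiplied record — + the
  identification with the record's pencil (27930's wall) — no theorem of the [II] chain is left un-read at the cap.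

v8.2's header (gen 5) follows unchanged; its HONEST FRAMING governs the whole file.  Nothing of Bałaban's is asserted; 26648 ∕ 27930–27932
OPEN; stub 2′ OPEN; K0⁷ NOT closed; finite 𝕋⁴ at fixed ε; the Yang–Mills mass gap is NOT proved by any of this.  No `sorry`, no `instance`,
no `notation`, no axiom, no `set_option allowUnsafeReducibility`.

--- (gen 5 header, verbatim) ---
# LENS-2 (gen 5) — the ZERO-INPUT SPLIT's fixed-scale piece (L♭): CRIT-1's pending «one reading claim» (U-c) settled IN KERNEL at the
# three typed levels of the tree's [II] chain; (L♭) typed as a level-indexed item with its chain to the wall; the record-side real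
# interpolation that anchors the `z`-family; separation ∕ firing models (rule (N))

Unit `ymgap-nodeO-lens-2-g5` (LENS IDEATOR 2, lens (ii) «RG map as a flow on a space of formats»), crux K0⁷ `stmt-QuantumFields-20541`,
target = record stub 2′ `K0V23Defs.stub_absBetaBoxAtThm1WitnessCCMGenGridGZB13` via the typer's wall item 27930‴ (uniform-in-k `FP.FormatPlus`
of the record's pieces).  Continuation of the tree files `Cruxes/Record13SepCoPHInhabited/Lens2G4ZeroInputSplitSketch.lean` (Sketch v7) and
`…/Lens2G4ZeroInputTermDefs.lean` (DN0 precheck v3); those crux modules are outside the farm build (import ⇒ `remote:stale:unbuilt`), so the few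
declarations of theirs this file needs are re-declared VERBATIM in §2–§3 (marked «twin of …»), nothing else is copied.

CRIT-1's verdict on gen 4 (HOME STATUS l.3551 (4)): the Schwarz route (L♭) is «M, print-derived, ONE READING CLAIM PENDING» — U-c: *the step
accepts COMPLEX multiples `z·𝐄_k` of the history with `|z|·E < Ē′` and its output pieces are analytic in `z`; history enters only through
Lemma 1's linear analytic image `V′_k` ((1.33)–(1.36) p. 9); `P^{(k)}`, `Q` history-free; no one-sided bound on `Re V′_k` used anywhere in
(2.1), (2.15)–(2.26)*.  WHAT THIS FILE PROVES (kernel, 0 sorry):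

* §1 U-c AT THE TREE's TYPED LEVELS of [Balaban1988RG2Cluster].  (a) `bound136_histMul` — the (1.36) row `B13.Bound136` is a MODULUS bound
  LINEAR in the format letter `E₀` (`B13.lean` :343–347): for any complex `z` with `‖z‖·E₀ ≤ E′` the scaled history image `z·V″` obeys (1.36)
  with the constants `c.withE₀ E′` (every other letter of `B13.Consts` unchanged); `lemma1Printed_histMul` ∕ `lemma2Printed_histMul` — the
  whole typed content of Lemmas 1–2 (`B13.Lemma1Printed`, `B13.Lemma2Printed` :355–384: analyticity, (1.42), (1.43), (1.36), gauge
  invariance) is CLOSED under the history multiplier (`Q`, `quadForm` untouched; (1.43)'s constant is `E₀`-free), given only that the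
  reader-owned predicates `S.Analytic`, `S.GaugeInv` are closed under `f ↦ w·f` and `(f, g) ↦ f + w·g` — NO reality ∕ positivity binder
  touches `Vp ∕ Vpp ∕ V` in the carrier.  (b) `F214_histMul_eq` ∕ `F214_histMul_differentiable` — in the last line of (2.14)
  (`B13Term214.F214` :408, `cexp (∑ τ(Y)·V(Y, B))`) a history multiplier `z` on the `V″`-part is ONE complex factor `cexp (z·Σ τ(Y)V″(Y,B))`:
  the printed integrand is ENTIRE in `z` — `z` rides on print's own complex interpolation parameters `τ(Y)` ((2.18) p. 16).
  (c) `shape220_histMul` — the (2.20)-shape modulus hypothesis `h220R` of `B13Lemma3TorusPrimitive.h226_torus_of_primitives` (:226,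
  `Σ_Y |τ(Y)|·‖V(Y,B)‖ ≤ a₂₀/2·q(B) + w`) is closed under `V ↦ V_q + z·V_h` with constants `(a_q + ρ a_h, w_q + ρ w_h)`, `‖z‖ ≤ ρ`.
  (d) PRINT's SLOPE: `C3act_withE₀` — the activity constant `C3act = 2(L+2)⁴A₁(E₀K₀)` (:183) at scale `E′` is `E′`-LINEAR, so the Schwarz
  slope of the (2.41) output `ρ♭ := 2·A₂·C3act(E′)·ε₁ ∕ E′ = 4(L+2)⁴A₁A₂K₀ε₁` is `E′`-FREE (`schwarzSlope_eq`), and `ρ♭ ≤ 1 ↔ R23 at scale E′`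
  (`schwarzSlope_le_one_iff`, `B13.Consts.R23` :214) — the closure letter of the split is print's restriction R23, no new letter.
* §2 (L♭) AS A TYPED, LEVEL-INDEXED ITEM over abstract record data (v8.1: + `flat_of_dChannelContraction` — (L) ⟹ (L♭) by the
  trivial linear family, CRIT-1 l.3594: at statement level (L♭) ≅ (L), its value is as the PROOF ROUTE; v8.2: + `formatPlusG_add` ∕
  `formatPlusG_of_split` — the split recombines in the vehicle of record `FormatPlusG` (B12FormatPlus v3 ✓p791826) row for row) (every `record…` name a variable, as in Sketch v7 §2): `DChannelFlat`
  (for every level `k`, admissible history `v`, history format level `0 < E < Ē′` reached by all previous levels: a `z`-family of piece systems,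
  differentiable in `z` on the disc `|z| < Ē′/E` at every admissible coordinate point, uniformly (1.18)-bounded by ONE constant `C` there,
  vanishing at `z = 0`, whose `z = 1` member carries the four other rows for `Φ k v − Φz k v`); `dChannelContraction_of_flat` — (L♭) ⟹ (L) with
  `ρ := C ∕ Ē′` for every `Ē < Ē′` (Schwarz, `bound118_of_schwarz`, CRIT-1 typing note (a): `0 < E ≤ Ē < Ē′`); `FlatSplitItem` = ONE `∃ σ Ē Ē′ C`
  with guards `0 < σ`, `0 ≤ C < Ē′`, `0 < Ē < Ē′`, closure `σ ≤ (1 − C/Ē′)·Ē`, conjuncts (Z) ∧ (L♭); `wall_of_flatSplitItem` — it implies the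
  wall's body with `E₀ := σ ∕ (1 − C/Ē′)` (full-memory Grönwall of v7, re-declared).
* §3 RECORD SIDE (imports `Node00.BackgroundActionT`; twins of DN0 precheck v3 §1–§2): the REAL interpolation `histInterpT t := R_k(A⁰_k + t·𝐄_k)`
  through the ONE step functional `stepOutT` with explicit input action; `histInterpT_one : … 1 = mergedTermT …` (𝓝_{k+1}),
  `histInterpT_zero : … 0 = stepOutT … (mainTermT …)` (𝓝⁰_{k+1}); `dChannelInterpT t := histInterpT t − histInterpT 0` with
  `dChannelInterpT_zero = 0` and `dChannelInterpT_one = 𝓝 − 𝓝⁰` — the real segment on which (L♭)'s `z`-family is ANCHORED to the record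
  (identity theorem: a `z`-analytic family agreeing with `t ↦ 𝓓_{k+1}(t)` on `(−Ē′/E, Ē′/E)` is unique).  Definitions + `simp`/`ring` only.
* §4 MODELS (rule (N), addendum №403): Toy D — (Z), (L♭) and the flat item hold NON-VACUOUSLY in the toy mould and the chain fires
  (`toyD_flat`, `toyD_flatSplitItem`, `toyD_wall`); Toy A♭ — the WALL and (Z) hold while the flat item FAILS (`toyA_not_flatSplitItem`, by the
  Schwarz lemma itself): the wall does NOT inhabit (L♭) — (L♭) is not 2′∕27930‴ in costume for this typing.

HONEST FRAMING.  Bookkeeping over the Literature carriers only.  §1 shows that the HYPOTHESIS SHAPES the tree gives [II]'s Lemmas 1–3 are closed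
under a complex history multiplier and that (2.14)'s last line is entire in it; it does NOT prove Lemma 1 ((1.33)–(1.36)), Lemma 3 ((2.26) ⇒
(2.38)) or the [26]-step for anything, least of all for the record; the `z`-analyticity of the KP-resummed output `E^{(k+1)}(X)(z)` on the disc is
print-native (p. 15 «the activities in (2.13), and the whole sum E^{(k+1)}(X), are analytic functions», KP region uniform in `z` by (2.38) at
scale `Ē′`) but UNPORTED.  (Z), (L), (L♭) are [support]-shaped sub-targets of 27930‴, never replacements; 27930–27932 OPEN and UNSIGNED; stub 2′
OPEN; K0⁷ NOT closed; NODE O not inhabited; COUNT 8∕28 · K 1∕4 unmoved; finite 𝕋⁴ at fixed ε — NOT continuum ∕ OS ∕ Clay; the Yang–Mills mass gap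
is NOT proved by any of this.  No `sorry`, no `instance`, no `notation`, no new axiom, no `set_option allowUnsafeReducibility`.
-/

namespace Summit.QuantumFields.YangMills.Cruxes.Record13SepCoPHInhabited.Lens2G6

open Literature.MathematicalPhysics.QuantumFieldTheory.Balaban1983to89
open Literature.MathematicalPhysics.QuantumFieldTheory.Balaban1983to89.B12FormatPlus
open _root_.Filter _root_.Topology

noncomputable section

/-! ## §1. U-c in kernel: the tree's typed [II] inputs are closed under a complex history multiplier -/

section UcConsts

/-- The constants of [II] with the format letter `E₀` set to `E'`, every other letter kept. [cite: Balaban1988RG2Cluster, §§1–2 (constants)] -/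
def withE₀ (c : B13.Consts) (E' : ℝ) : B13.Consts := { c with E₀ := E' }

@[simp] theorem withE₀_E₀ (c : B13.Consts) (E' : ℝ) : (withE₀ c E').E₀ = E' := rfl
@[simp] theorem withE₀_ε₁ (c : B13.Consts) (E' : ℝ) : (withE₀ c E').ε₁ = c.ε₁ := rfl
@[simp] theorem withE₀_A₂ (c : B13.Consts) (E' : ℝ) : (withE₀ c E').A₂ = c.A₂ := rfl
@[simp] theorem withE₀_L (c : B13.Consts) (E' : ℝ) : (withE₀ c E').L = c.L := rfl

/-- The `E₀`-free kernel `K₀` is unchanged. [cite: Balaban1988RG2Cluster, p.19 (definition of ε₂)] -/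
@[simp] theorem K₀_withE₀ (c : B13.Consts) (E' : ℝ) : (withE₀ c E').K₀ = c.K₀ := rfl

/-- `ε₂ = E₀ε₁K₀` at scale `E'` (linear in the scale). [cite: Balaban1988RG2Cluster, p.19] -/
theorem eps2_withE₀ (c : B13.Consts) (E' : ℝ) : (withE₀ c E').eps2 = E' * c.ε₁ * c.K₀ := rfl

/-- **The activity constant at scale `E'` is `E'`-LINEAR**: `C3act(E') = 2(L+2)⁴A₁·(E'·K₀)`. [cite: Balaban1988RG2Cluster, p.20 (C₃ of (2.38))] -/
theorem C3act_withE₀ (c : B13.Consts) (E' : ℝ) : (withE₀ c E').C3act = 2 * ((c.L : ℝ) + 2) ^ 4 * c.A₁ * (E' * c.K₀) := rfl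

/-- **The Schwarz slope of the (2.41) output is scale-free**: `2·A₂·C3act(E')·ε₁ / E' = 4(L+2)⁴A₁A₂K₀ε₁` (the factor 2 is the price of
`D(z) = out(z) − out(0)`). [cite: Balaban1988RG2Cluster, (2.41) p.21 with C₃ ∝ E₀ p.20] -/
theorem schwarzSlope_eq (c : B13.Consts) {E' : ℝ} (hE' : E' ≠ 0) :
    2 * ((withE₀ c E').A₂ * (withE₀ c E').C3act * (withE₀ c E').ε₁) / E' =
      4 * ((c.L : ℝ) + 2) ^ 4 * c.A₁ * c.A₂ * c.K₀ * c.ε₁ := by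
  rw [C3act_withE₀, withE₀_A₂, withE₀_ε₁]
  field_simp
  ring

/-- **The split's closure letter is print's R23**: slope `≤ 1` iff `A₂·C3act(E')·ε₁ ≤ E'/2`, i.e. `B13.Consts.R23` at scale `E'`.
[cite: Balaban1988RG2Cluster, p.21 "O(1)C₃ε₁ ≤ ½E₀" (R23)] -/
theorem schwarzSlope_le_one_iff (c : B13.Consts) {E' : ℝ} (hE' : 0 < E') :
    2 * ((withE₀ c E').A₂ * (withE₀ c E').C3act * (withE₀ c E').ε₁) / E' ≤ 1 ↔ (withE₀ c E').R23 := by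
  rw [B13.Consts.R23, withE₀_E₀, div_le_iff₀ hE']
  constructor <;> intro h <;> linarith

end UcConsts

section UcStep

/-- **U-c for the (1.36) row.**  `B13.Bound136` is a modulus bound linear in `E₀`: a complex history multiplier `z` with `‖z‖·E₀ ≤ E'`
keeps (1.36) with the constants at scale `E'`. [cite: Balaban1988RG2Cluster, (1.36) p.9] -/
theorem bound136_histMul (S : B13.StepData) (c : B13.Consts) (F : S.Dk.Dom → S.Φ → ℂ) (z : ℂ) {E' : ℝ}
    (h : B13.Bound136 S c F) (hz : ‖z‖ * c.E₀ ≤ E') (hε : 0 ≤ c.ε₁) (hC : 0 ≤ c.C₁) (hM : 0 ≤ c.M ^ c.q) :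
    B13.Bound136 S (withE₀ c E') (fun Y φ => z * F Y φ) := by
  intro Y φ hφ
  have h1 := h Y φ hφ
  have hK : 0 ≤ c.ε₁ * c.C₁ * c.M ^ c.q * Real.exp (c.C₂ * c.κ₁) *
      Real.exp (-((1 - 2 * c.δ) * c.κ * S.Dk.dj Y)) :=
    mul_nonneg (mul_nonneg (mul_nonneg (mul_nonneg hε hC) hM) (Real.exp_nonneg _)) (Real.exp_nonneg _)
  show ‖z * F Y φ‖ ≤ E' * c.ε₁ * c.C₁ * c.M ^ c.q * Real.exp (c.C₂ * c.κ₁) *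
      Real.exp (-((1 - 2 * c.δ) * c.κ * S.Dk.dj Y))
  rw [norm_mul]
  calc ‖z‖ * ‖F Y φ‖
      ≤ ‖z‖ * (c.E₀ * c.ε₁ * c.C₁ * c.M ^ c.q * Real.exp (c.C₂ * c.κ₁) *
          Real.exp (-((1 - 2 * c.δ) * c.κ * S.Dk.dj Y))) := mul_le_mul_of_nonneg_left h1 (norm_nonneg z)
    _ = (‖z‖ * c.E₀) * (c.ε₁ * c.C₁ * c.M ^ c.q * Real.exp (c.C₂ * c.κ₁) *
          Real.exp (-((1 - 2 * c.δ) * c.κ * S.Dk.dj Y))) := by ring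
    _ ≤ E' * (c.ε₁ * c.C₁ * c.M ^ c.q * Real.exp (c.C₂ * c.κ₁) *
          Real.exp (-((1 - 2 * c.δ) * c.κ * S.Dk.dj Y))) := mul_le_mul_of_nonneg_right hz hK
    _ = _ := by ring

/-- **The [II] step data with the HISTORY CHANNEL multiplied by `z`**: `V′ ↦ z·V′`, `V″ ↦ z·V″`, `V ↦ V + (z − 1)·V″` (`= ½⟨Q B, B⟩ + z·V″`
on the space (1.34) by (1.42); `Q`, the main action's form, untouched); domains, spaces, outputs, predicates kept.  (The outputs `H`, `Ek1`,
`Elog` are carrier data, not functions of the inputs — §1 is about the INPUT rows only.) [cite: Balaban1988RG2Cluster, (1.33), (1.41)–(1.42) pp.9–11] -/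
def histMul (S : B13.StepData) (z : ℂ) : B13.StepData :=
  { S with
    Vp := fun Y φ => z * S.Vp Y φ
    Vpp := fun Y φ => z * S.Vpp Y φ
    V := fun Y φ => S.V Y φ + (z - 1) * S.Vpp Y φ }

/-- The quadratic form (1.42) is untouched by the history multiplier (definitionally). -/
theorem histMul_quadForm (S : B13.StepData) (z : ℂ) (Y : S.Dk.Dom) (φ : S.Φ) :
    (histMul S z).quadForm Y φ = S.quadForm Y φ := rfl

/-- **U-c for Lemma 1's typed content** (analyticity of `V′` on (1.34) ∧ (1.36)): closed under the history multiplier at scale `E' ≥ ‖z‖E₀`,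
given closure of the reader-owned analyticity predicate under scalar multiples. [cite: Balaban1988RG2Cluster, Lemma 1 p.9] -/
theorem lemma1Printed_histMul (S : B13.StepData) (c : B13.Consts) (z : ℂ) {E' : ℝ} (h1 : B13.Lemma1Printed S c)
    (hz : ‖z‖ * c.E₀ ≤ E') (hε : 0 ≤ c.ε₁) (hC : 0 ≤ c.C₁) (hM : 0 ≤ c.M ^ c.q)
    (hAsmul : ∀ (f : S.Φ → ℂ) (s : Set S.Φ) (w : ℂ), S.Analytic f s → S.Analytic (fun φ => w * f φ) s) :
    B13.Lemma1Printed (histMul S z) (withE₀ c E') := by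
  refine ⟨fun Y => hAsmul (S.Vp Y) (S.sp1 Y) z (h1.1 Y), ?_⟩
  intro Y φ hφ
  exact bound136_histMul S c S.Vp z h1.2 hz hε hC hM Y φ hφ

/-- **U-c for Lemma 2's typed content** (analyticity of `V`, (1.42), (1.43), (1.36) for `V″`, gauge invariance of `V`, `½⟨QB,B⟩`, `V″`):
CLOSED under the history multiplier at scale `E' ≥ ‖z‖E₀` — (1.43)'s constant `C₃ε₁M⁴e^{C₂κ₁}` is `E₀`-free and `Q` is untouched; (1.36)
by `bound136_histMul`; the rest by closure of the reader-owned predicates under `f + w·g` and `w·f`.  No reality or positivity property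
of `V′, V″, V` is a field of the carrier, so none can be violated. [cite: Balaban1988RG2Cluster, Lemma 2 p.11] -/
theorem lemma2Printed_histMul (S : B13.StepData) (c : B13.Consts) (z : ℂ) {E' : ℝ}
    (h1 : B13.Lemma1Printed S c) (hVpp : S.Vpp = S.Vp) (h2 : B13.Lemma2Printed S c)
    (hz : ‖z‖ * c.E₀ ≤ E') (hε : 0 ≤ c.ε₁) (hC : 0 ≤ c.C₁) (hM : 0 ≤ c.M ^ c.q)
    (hAadd : ∀ (f g : S.Φ → ℂ) (s : Set S.Φ) (w : ℂ), S.Analytic f s → S.Analytic g s →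
      S.Analytic (fun φ => f φ + w * g φ) s)
    (hGsmul : ∀ (f : S.Φ → ℂ) (w : ℂ), S.GaugeInv f → S.GaugeInv (fun φ => w * f φ))
    (hGadd : ∀ (f g : S.Φ → ℂ) (w : ℂ), S.GaugeInv f → S.GaugeInv g → S.GaugeInv (fun φ => f φ + w * g φ)) :
    B13.Lemma2Printed (histMul S z) (withE₀ c E') := by
  obtain ⟨hVan, hrepr, hQ, h136, hG⟩ := h2
  have hVppAn : ∀ Y, S.Analytic (S.Vpp Y) (S.sp1 Y) := fun Y => by rw [hVpp]; exact h1.1 Y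
  refine ⟨?_, ?_, ?_, ?_, ?_⟩
  · intro Y
    exact hAadd (S.V Y) (S.Vpp Y) (S.sp1 Y) (z - 1) (hVan Y) (hVppAn Y)
  · intro Y φ hφ
    show S.V Y φ + (z - 1) * S.Vpp Y φ = S.quadForm Y φ + z * S.Vpp Y φ
    rw [hrepr Y φ hφ]
    ring
  · intro Y φ b b' hφ
    exact hQ Y φ b b' hφ
  · intro Y φ hφ
    exact bound136_histMul S c S.Vpp z h136 hz hε hC hM Y φ hφ
  · intro Y
    exact ⟨hGadd (S.V Y) (S.Vpp Y) (z - 1) (hG Y).1 (hG Y).2.2, (hG Y).2.1, hGsmul (S.Vpp Y) z (hG Y).2.2⟩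

/-- For the CONCRETE analyticity predicate of the β-road mould (`AnalyticOnNhd`, `B12FormatPlus.Analytic19`) the two closure hypotheses
hold (so they are no assumption there). [folklore] -/
theorem analyticOnNhd_closure {Φ : Type*} [NormedAddCommGroup Φ] [NormedSpace ℂ Φ] :
    (∀ (f : Φ → ℂ) (s : Set Φ) (w : ℂ), AnalyticOnNhd ℂ f s → AnalyticOnNhd ℂ (fun φ => w * f φ) s) ∧
    (∀ (f g : Φ → ℂ) (s : Set Φ) (w : ℂ), AnalyticOnNhd ℂ f s → AnalyticOnNhd ℂ g s →
      AnalyticOnNhd ℂ (fun φ => f φ + w * g φ) s) :=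
  ⟨fun _ _ _ hf => analyticOnNhd_const.mul hf, fun _ _ _ _ hf hg => hf.add (analyticOnNhd_const.mul hg)⟩

end UcStep

section UcLine214

variable {Λ : Type} {D : Type*}

/-- The history exponent splits off ONE complex factor. -/
theorem sum_histMul_split (Dfam : Finset D) (Vq Vh : D → (Λ → ℝ) → ℂ) (τ : D → ℂ) (B : Λ → ℝ) (z : ℂ) :
    ∑ Y ∈ Dfam, τ Y * (Vq Y B + z * Vh Y B) =
      (∑ Y ∈ Dfam, τ Y * Vq Y B) + z * ∑ Y ∈ Dfam, τ Y * Vh Y B := by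
  rw [Finset.mul_sum, ← Finset.sum_add_distrib]
  exact Finset.sum_congr rfl fun Y _ => by ring

/-- **U-c in (2.14)'s last line**: with the potentials split as `V = V_q + z·V_h` (main-action part + multiplied history part), the printed
factor `(−1)^{|P|}χχᶜ exp[Σ τ(Y)V(Y,B)]` is the history-free factor (`V = V_q`) times ONE exponential `cexp (z·Σ τ(Y)V_h(Y,B))` — the
multiplier rides on print's complex `τ(Y)`. [cite: Balaban1988RG2Cluster, (2.14) p.15, (2.18) p.16] -/
theorem F214_histMul_eq (cardP : ℕ) (χY₀ χcP : (Λ → ℝ) → ℝ) (Dfam : Finset D) (Vq Vh : D → (Λ → ℝ) → ℂ)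
    (τ : D → ℂ) (B : Λ → ℝ) (z : ℂ) :
    B13Term214.F214 cardP χY₀ χcP Dfam (fun Y B => Vq Y B + z * Vh Y B) τ B =
      B13Term214.F214 cardP χY₀ χcP Dfam Vq τ B * Complex.exp (z * ∑ Y ∈ Dfam, τ Y * Vh Y B) := by
  simp only [B13Term214.F214]
  rw [sum_histMul_split, Complex.exp_add]
  ring

/-- **(2.14)'s last line is ENTIRE in the history multiplier.** [cite: Balaban1988RG2Cluster, (2.14) p.15] -/
theorem F214_histMul_differentiable (cardP : ℕ) (χY₀ χcP : (Λ → ℝ) → ℝ) (Dfam : Finset D) (Vq Vh : D → (Λ → ℝ) → ℂ)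
    (τ : D → ℂ) (B : Λ → ℝ) :
    Differentiable ℂ fun z : ℂ => B13Term214.F214 cardP χY₀ χcP Dfam (fun Y B => Vq Y B + z * Vh Y B) τ B := by
  have h : ∀ z : ℂ, B13Term214.F214 cardP χY₀ χcP Dfam (fun Y B => Vq Y B + z * Vh Y B) τ B =
      B13Term214.F214 cardP χY₀ χcP Dfam Vq τ B * Complex.exp (z * ∑ Y ∈ Dfam, τ Y * Vh Y B) :=
    fun z => F214_histMul_eq cardP χY₀ χcP Dfam Vq Vh τ B z
  simp_rw [h]
  exact (differentiable_const _).mul ((differentiable_id.mul (differentiable_const _)).cexp)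

/-- **U-c for the (2.20)-shape** (`h220R` of `B13Lemma3TorusPrimitive.h226_torus_of_primitives`): the modulus hypothesis
`Σ_Y R(Y)·‖V(Y,B)‖ ≤ a/2·q(B) + w` is closed under `V ↦ V_q + z·V_h`, `‖z‖ ≤ ρ`, constants `(a_q + ρ a_h, w_q + ρ w_h)`.
[cite: Balaban1988RG2Cluster, (2.19)–(2.20) p.16] -/
theorem shape220_histMul (Dfam : Finset D) (R : D → ℝ) (hR : ∀ Y, 0 ≤ R Y) (q : (Λ → ℝ) → ℝ)
    (Vq Vh : D → (Λ → ℝ) → ℂ) {aq wq ah wh ρ : ℝ} (z : ℂ) (hz : ‖z‖ ≤ ρ)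
    (hq : ∀ B, ∑ Y ∈ Dfam, R Y * ‖Vq Y B‖ ≤ aq / 2 * q B + wq)
    (hh : ∀ B, ∑ Y ∈ Dfam, R Y * ‖Vh Y B‖ ≤ ah / 2 * q B + wh) :
    ∀ B, ∑ Y ∈ Dfam, R Y * ‖Vq Y B + z * Vh Y B‖ ≤ (aq + ρ * ah) / 2 * q B + (wq + ρ * wh) := by
  intro B
  have hS : 0 ≤ ∑ Y ∈ Dfam, R Y * ‖Vh Y B‖ := Finset.sum_nonneg fun Y _ => mul_nonneg (hR Y) (norm_nonneg _)
  calc ∑ Y ∈ Dfam, R Y * ‖Vq Y B + z * Vh Y B‖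
      ≤ ∑ Y ∈ Dfam, (R Y * ‖Vq Y B‖ + ‖z‖ * (R Y * ‖Vh Y B‖)) := Finset.sum_le_sum fun Y _ => by
          have h1 : ‖Vq Y B + z * Vh Y B‖ ≤ ‖Vq Y B‖ + ‖z‖ * ‖Vh Y B‖ := by
            refine (norm_add_le _ _).trans ?_
            rw [norm_mul]
          have h2 := mul_le_mul_of_nonneg_left h1 (hR Y)
          linarith [h2]
    _ = (∑ Y ∈ Dfam, R Y * ‖Vq Y B‖) + ‖z‖ * ∑ Y ∈ Dfam, R Y * ‖Vh Y B‖ := by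
          rw [Finset.sum_add_distrib, Finset.mul_sum]
    _ ≤ (aq / 2 * q B + wq) + ρ * (ah / 2 * q B + wh) := add_le_add (hq B)
          ((mul_le_mul_of_nonneg_right hz hS).trans (mul_le_mul_of_nonneg_left (hh B) ((norm_nonneg z).trans hz)))
    _ = (aq + ρ * ah) / 2 * q B + (wq + ρ * wh) := by ring

end UcLine214

/-! ## §2. (L♭) typed as a level-indexed item; (L♭) ⟹ (L); the flat split ⟹ the wall -/

section Mould

variable {S : ℕ → LocDomainSys} {M m : ℕ → ℕ}
  {Uc : (n : ℕ) → (S n).Dom → Set (Fin (M n) → ℂ)} {coords : (n : ℕ) → (S n).Dom → Finset (Fin (M n))}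
  {χ : (n : ℕ) → (S n).Dom → (Fin (m n) → ℂ) → (Fin (M n) → ℂ)} {W : ℕ → Type*} [∀ n, TopologicalSpace (W n)]
  [∀ n, Zero (W n)] {Φ₁ Φ₂ Φf Ψ : (n : ℕ) → W n → ℂ} {ι : (n : ℕ) → W n → (Fin (m n) → ℂ)}
  {wrap : (n : ℕ) → Finset (S n).Dom} {emb : (n : ℕ) → (S n).Dom → (S (n + 1)).Dom}
  {πc : (n : ℕ) → (S n).Dom → (Fin (M (n + 1)) → ℂ) → (Fin (M n) → ℂ)} {E₁ E₂ E₀ κ : ℝ}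

/-- Pieces add (twin of Sketch v7 `formatPlus_add`). -/
theorem formatPlus_add (h₁ : FormatPlus S M Uc coords m χ Φ₁ ι wrap emb πc E₁ κ)
    (h₂ : FormatPlus S M Uc coords m χ Φ₂ ι wrap emb πc E₂ κ) :
    FormatPlus S M Uc coords m χ (fun n B => Φ₁ n B + Φ₂ n B) ι wrap emb πc (E₁ + E₂) κ := by
  obtain ⟨P, hA, hB, hL, hR, hV⟩ := h₁
  obtain ⟨Q, hA', hB', hL', hR', hV'⟩ := h₂
  refine ⟨fun n X u => P n X u + Q n X u, ?_, ?_, ?_, ?_, ?_⟩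
  · intro n X
    exact (hA n X).add (hA' n X)
  · intro n X u hu
    calc ‖P n X u + Q n X u‖ ≤ ‖P n X u‖ + ‖Q n X u‖ := norm_add_le _ _
      _ ≤ E₁ * Real.exp (-κ * (S n).dj X) + E₂ * Real.exp (-κ * (S n).dj X) :=
          add_le_add (hB n X u hu) (hB' n X u hu)
      _ = (E₁ + E₂) * Real.exp (-κ * (S n).dj X) := by ring
  · intro n X u u' h
    exact congrArg₂ (· + ·) (hL n X u u' h) (hL' n X u u' h)
  · intro n
    filter_upwards [hR n, hR' n] with B h1 h2
    rw [h1, h2, ← Finset.sum_add_distrib]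
  · intro n X hX u'
    exact congrArg₂ (· + ·) (hV n X hX u') (hV' n X hX u')

/-- **The (1.19) row adds** — 27930⁗'s vehicle `FormatPlusG` = `FormatPlus` + `GaugeInv119` (PRINT-ROAD rev 3 §7.1): the split glue
carries over verbatim with the (1.19) row appended to (Z) and to (L♭)'s `z = 1` member. [cite: Balaban1987RG1, (1.19) p.263] -/
theorem gaugeInv119_add {G : ℕ → Type*} {act : (n : ℕ) → G n → (Fin (M n) → ℂ) → (Fin (M n) → ℂ)} {P Q : Pieces S M}
    (hP : GaugeInv119 act Uc P) (hQ : GaugeInv119 act Uc Q) :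
    GaugeInv119 act Uc (fun n X u => P n X u + Q n X u) :=
  ⟨hP.1, fun n g X u => congrArg₂ (· + ·) (hP.2 n g X u) (hQ.2 n g X u)⟩

/-- **Pieces add in the `FormatPlusG` vehicle itself** (B12FormatPlus v3 ✓p791826 `FormatPlusG` :460 = the five rows ∧ (1.19) for
the SAME pieces): formats add, the (1.19) row included. [cite: Balaban1987RG1, (1.18)–(1.19) p.263] -/
theorem formatPlusG_add {G : ℕ → Type*} {act : (n : ℕ) → G n → (Fin (M n) → ℂ) → (Fin (M n) → ℂ)}
    (h₁ : FormatPlusG S M act Uc coords m χ Φ₁ ι wrap emb πc E₁ κ)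
    (h₂ : FormatPlusG S M act Uc coords m χ Φ₂ ι wrap emb πc E₂ κ) :
    FormatPlusG S M act Uc coords m χ (fun n B => Φ₁ n B + Φ₂ n B) ι wrap emb πc (E₁ + E₂) κ := by
  obtain ⟨P, hA, hB, hL, hR, hV, hG⟩ := h₁
  obtain ⟨Q, hA', hB', hL', hR', hV', hG'⟩ := h₂
  refine ⟨fun n X u => P n X u + Q n X u, ?_, ?_, ?_, ?_, ?_, gaugeInv119_add hG hG'⟩
  · intro n X
    exact (hA n X).add (hA' n X)
  · intro n X u hu
    calc ‖P n X u + Q n X u‖ ≤ ‖P n X u‖ + ‖Q n X u‖ := norm_add_le _ _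
      _ ≤ E₁ * Real.exp (-κ * (S n).dj X) + E₂ * Real.exp (-κ * (S n).dj X) :=
          add_le_add (hB n X u hu) (hB' n X u hu)
      _ = (E₁ + E₂) * Real.exp (-κ * (S n).dj X) := by ring
  · intro n X u u' h
    exact congrArg₂ (· + ·) (hL n X u u' h) (hL' n X u u' h)
  · intro n
    filter_upwards [hR n, hR' n] with B h1 h2
    rw [h1, h2, ← Finset.sum_add_distrib]
  · intro n X hX u'
    exact congrArg₂ (· + ·) (hV n X hX u') (hV' n X hX u')

/-- The `FormatPlusG` mould reads only the germ at `0`. -/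
theorem formatPlusG_congr {G : ℕ → Type*} {act : (n : ℕ) → G n → (Fin (M n) → ℂ) → (Fin (M n) → ℂ)}
    (h : FormatPlusG S M act Uc coords m χ Φf ι wrap emb πc E₀ κ) (heq : ∀ n, ∀ᶠ B in 𝓝 (0 : W n), Ψ n B = Φf n B) :
    FormatPlusG S M act Uc coords m χ Ψ ι wrap emb πc E₀ κ := by
  obtain ⟨P, hA, hB, hL, hR, hV, hG⟩ := h
  refine ⟨P, hA, hB, hL, ?_, hV, hG⟩
  intro n
  filter_upwards [hR n, heq n] with B h1 h2
  rw [h2, h1]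

/-- **The split recombined in the `FormatPlusG` vehicle**: (Z) at `σ` and the history channel at `τ`, both with the (1.19) row,
give 27930⁗'s mould at `σ + τ` — so the whole §2 chain ports to the vehicle of record row for row. -/
theorem formatPlusG_of_split {G : ℕ → Type*} {act : (n : ℕ) → G n → (Fin (M n) → ℂ) → (Fin (M n) → ℂ)}
    {Φ Φz : (n : ℕ) → W n → ℂ} {σ τ : ℝ}
    (hZ : FormatPlusG S M act Uc coords m χ Φz ι wrap emb πc σ κ)
    (hD : FormatPlusG S M act Uc coords m χ (fun n B => Φ n B - Φz n B) ι wrap emb πc τ κ) :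
    FormatPlusG S M act Uc coords m χ Φ ι wrap emb πc (σ + τ) κ :=
  formatPlusG_congr (formatPlusG_add hZ hD) fun n => Filter.Eventually.of_forall fun B => by
    show Φ n B = Φz n B + (Φ n B - Φz n B)
    ring

/-- The mould reads only the germ at `0` (twin of v7 `formatPlus_congr`). -/
theorem formatPlus_congr (h : FormatPlus S M Uc coords m χ Φf ι wrap emb πc E₀ κ)
    (heq : ∀ n, ∀ᶠ B in 𝓝 (0 : W n), Ψ n B = Φf n B) :
    FormatPlus S M Uc coords m χ Ψ ι wrap emb πc E₀ κ := by
  obtain ⟨P, hA, hB, hL, hR, hV⟩ := h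
  refine ⟨P, hA, hB, hL, ?_, hV⟩
  intro n
  filter_upwards [hR n, heq n] with B h1 h2
  rw [h2, h1]

/-- The split recombined (twin of v7 `formatPlus_of_split`). -/
theorem formatPlus_of_split {Φ Φz : (n : ℕ) → W n → ℂ} {σ τ : ℝ}
    (hZ : FormatPlus S M Uc coords m χ Φz ι wrap emb πc σ κ)
    (hD : FormatPlus S M Uc coords m χ (fun n B => Φ n B - Φz n B) ι wrap emb πc τ κ) :
    FormatPlus S M Uc coords m χ Φ ι wrap emb πc (σ + τ) κ :=
  formatPlus_congr (formatPlus_add hZ hD) fun n => Filter.Eventually.of_forall fun B => by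
    show Φ n B = Φz n B + (Φ n B - Φz n B)
    ring

/-- **Schwarz ⇒ the (1.18) row contracts linearly in the history scale** (twin of v7 `bound118_of_schwarz`). [cite: Balaban1988RG2Cluster, (2.38)–(2.41) pp.20–21 (mechanism); Mathlib Schwarz lemma] -/
theorem bound118_of_schwarz {S : ℕ → LocDomainSys} {M : ℕ → ℕ} (Uc : (n : ℕ) → (S n).Dom → Set (Fin (M n) → ℂ))
    (Ez : ℂ → Pieces S M) {R C κ : ℝ} (hR : 1 < R)
    (hd : ∀ n X u, u ∈ Uc n X → DifferentiableOn ℂ (fun z => Ez z n X u) (Metric.ball 0 R))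
    (hb : ∀ z ∈ Metric.ball (0 : ℂ) R, Bound118 S Uc (Ez z) C κ)
    (h0 : ∀ n X u, u ∈ Uc n X → Ez 0 n X u = 0) :
    Bound118 S Uc (Ez 1) (C / R) κ := by
  intro n X u hu
  have h1 : (1 : ℂ) ∈ Metric.ball (0 : ℂ) R := by
    rw [Metric.mem_ball, dist_zero_right, norm_one]; exact hR
  have hmaps : Set.MapsTo (fun z => Ez z n X u) (Metric.ball 0 R)
      (Metric.closedBall ((fun z => Ez z n X u) 0) (C * Real.exp (-κ * (S n).dj X))) := by
    intro z hz
    show dist (Ez z n X u) (Ez 0 n X u) ≤ C * Real.exp (-κ * (S n).dj X)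
    rw [h0 n X u hu, dist_zero_right]
    exact hb z hz n X u hu
  have hS := Complex.dist_le_div_mul_dist_of_mapsTo_ball (hd n X u hu) hmaps h1
  have hS' : dist (Ez 1 n X u) (Ez 0 n X u) ≤ C * Real.exp (-κ * (S n).dj X) / R * dist (1 : ℂ) 0 := hS
  rw [h0 n X u hu, dist_zero_right, dist_zero_right, norm_one, mul_one] at hS'
  calc ‖Ez 1 n X u‖ ≤ C * Real.exp (-κ * (S n).dj X) / R := hS'
    _ = C / R * Real.exp (-κ * (S n).dj X) := by ring

end Mould

section Flat

variable (S : ℕ → ℕ → LocDomainSys) (M m : ℕ → ℕ → ℕ)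
  (Uc : (k n : ℕ) → (S k n).Dom → Set (Fin (M k n) → ℂ)) (coords : (k n : ℕ) → (S k n).Dom → Finset (Fin (M k n)))
  (χ : (k n : ℕ) → (S k n).Dom → (Fin (m k n) → ℂ) → (Fin (M k n) → ℂ)) (W : ℕ → ℕ → Type*)
  [∀ k n, TopologicalSpace (W k n)] [∀ k n, Zero (W k n)]
  (Φ Φz : (k : ℕ) → (Fin (k + 1) → ℝ) → (n : ℕ) → W k n → ℂ) (ι : (k n : ℕ) → W k n → (Fin (m k n) → ℂ))
  (wrap : (k n : ℕ) → Finset (S k n).Dom) (emb : (k n : ℕ) → (S k n).Dom → (S k (n + 1)).Dom)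
  (πc : (k n : ℕ) → (S k n).Dom → (Fin (M k (n + 1)) → ℂ) → (Fin (M k n) → ℂ))

/-- THE WALL's body (twin of v7 `UniformFormat`): one constant `E₀` at every level and admissible history. -/
def UniformFormat (γ₀ E₀ κ : ℝ) : Prop :=
  ∀ k v, v ∈ FlowStep.Box γ₀ k →
    FormatPlus (S k) (M k) (Uc k) (coords k) (m k) (χ k) (Φ k v) (ι k) (wrap k) (emb k) (πc k) E₀ κ

/-- PIECE (Z) (twin of v7 `ZeroInputFormat`): the zero-input functional has format `σ` at every level. -/
def ZeroInputFormat (γ₀ σ κ : ℝ) : Prop :=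
  ∀ k v, v ∈ FlowStep.Box γ₀ k →
    FormatPlus (S k) (M k) (Uc k) (coords k) (m k) (χ k) (Φz k v) (ι k) (wrap k) (emb k) (πc k) σ κ

/-- PIECE (L) (twin of v7 `DChannelContraction`): for `0 < E ≤ Ē`, format `E` of all previous levels ⟹ format `ρ·E` of `Φ k v − Φz k v`. -/
def DChannelContraction (γ₀ ρ Ē κ : ℝ) : Prop :=
  ∀ k v, v ∈ FlowStep.Box γ₀ k → ∀ E : ℝ, 0 < E → E ≤ Ē →
    (∀ j, j < k → ∀ w, w ∈ FlowStep.Box γ₀ j →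
      FormatPlus (S j) (M j) (Uc j) (coords j) (m j) (χ j) (Φ j w) (ι j) (wrap j) (emb j) (πc j) E κ) →
    FormatPlus (S k) (M k) (Uc k) (coords k) (m k) (χ k) (fun n B => Φ k v n B - Φz k v n B) (ι k) (wrap k) (emb k)
      (πc k) (ρ * E) κ

/-- **PIECE (L♭) — the history channel at ONE fixed input scale `Ē'`, as an analytic family in the history multiplier.**  For every level
`k`, admissible `v` and every history format level `0 < E < Ē'` reached by ALL previous levels: there is a `z`-family `Ez : ℂ → Pieces` of
piece systems of member `k`, differentiable in `z` on the disc `|z| < Ē'/E` at every admissible coordinate point, (1.18)-bounded by the ONE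
constant `C` uniformly on the disc (Theorem 3's step OUTPUT bound at input scale `Ē'`: the scaled history `z·𝐄_k` has format `|z|·E < Ē'`),
vanishing at `z = 0` (no history ⇒ no response; k = 0: DN0 precheck `dChannel_zero_at_first_level'`), whose `z = 1` member is analytic,
local, volume-independent and represents `Φ k v − Φz k v` near `B = 0`.  (Print: [II] pp. 9, 15–16 — the history enters (2.14) only through
`V″ = V′` of (1.33), multiplied by the complex `τ(Y)` of (2.18); §1 above.) -/
def DChannelFlat (γ₀ Ē' C κ : ℝ) : Prop :=
  ∀ k v, v ∈ FlowStep.Box γ₀ k → ∀ E : ℝ, 0 < E → E < Ē' →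
    (∀ j, j < k → ∀ w, w ∈ FlowStep.Box γ₀ j →
      FormatPlus (S j) (M j) (Uc j) (coords j) (m j) (χ j) (Φ j w) (ι j) (wrap j) (emb j) (πc j) E κ) →
    ∃ Ez : ℂ → Pieces (S k) (M k),
      Analytic19 (Uc k) (Ez 1) ∧ Local17 (coords k) (Ez 1) ∧
      Repr17 (S k) (Ez 1) (χ k) (fun n B => Φ k v n B - Φz k v n B) (ι k) ∧
      PieceVolIndep (S k) (M k) (wrap k) (emb k) (πc k) (Ez 1) ∧
      (∀ n X u, u ∈ Uc k n X → DifferentiableOn ℂ (fun z => Ez z n X u) (Metric.ball 0 (Ē' / E))) ∧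
      (∀ z ∈ Metric.ball (0 : ℂ) (Ē' / E), Bound118 (S k) (Uc k) (Ez z) C κ) ∧
      (∀ n X u, u ∈ Uc k n X → Ez 0 n X u = 0)

/-- **(L♭) ⟹ (L)** with the `E`-free slope `ρ := C / Ē'`, on every closed range `0 < E ≤ Ē` with `Ē < Ē'` (CRIT-1 typing note (a)). -/
theorem dChannelContraction_of_flat {γ₀ Ē Ē' C κ : ℝ} (hĒ : Ē < Ē')
    (hF : DChannelFlat S M m Uc coords χ W Φ Φz ι wrap emb πc γ₀ Ē' C κ) :
    DChannelContraction S M m Uc coords χ W Φ Φz ι wrap emb πc γ₀ (C / Ē') Ē κ := by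
  intro k v hv E hE hEĒ hprev
  have hEĒ' : E < Ē' := lt_of_le_of_lt hEĒ hĒ
  obtain ⟨Ez, hA, hLoc, hR, hV, hd, hb, h0⟩ := hF k v hv E hE hEĒ' hprev
  have hR1 : 1 < Ē' / E := by rw [lt_div_iff₀ hE]; linarith
  have hB := bound118_of_schwarz (Uc k) Ez hR1 hd hb h0
  have hEq : C / (Ē' / E) = C / Ē' * E := by field_simp
  rw [hEq] at hB
  exact ⟨Ez 1, hA, hB, hLoc, hR, hV⟩

/-- **Conversely — (L) ⟹ (L♭)** with `Ē' := Ē`, `C := ρ·Ē`, by the TRIVIAL linear family `Ez := z·E₁` (CRIT-1's remark, HOME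
STATUS l.3594, in kernel): at STATEMENT level (L♭) ≅ (L); (L♭)'s value is as the PROOF ROUTE (the genuine complexified-history family
gets `C` from Theorem 3's output bound at ONE scale, no re-counting), not as a different item — the filed text `PortZeroInputSplitZD`
(№442) in the (Z) ∧ (L) form is the item, ZD♭ its named sub-line. -/
theorem flat_of_dChannelContraction {γ₀ ρ Ē κ : ℝ}
    (hL : DChannelContraction S M m Uc coords χ W Φ Φz ι wrap emb πc γ₀ ρ Ē κ) :
    DChannelFlat S M m Uc coords χ W Φ Φz ι wrap emb πc γ₀ Ē (ρ * Ē) κ := by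
  intro k v hv E hE hEĒ hprev
  obtain ⟨P, hA, hB, hLoc, hR, hV⟩ := hL k v hv E hE hEĒ.le hprev
  have hĒ0 : 0 ≤ Ē := (hE.trans hEĒ).le
  have hEne : E ≠ 0 := hE.ne'
  refine ⟨fun z n X u => z * P n X u, ?_, ?_, ?_, ?_, ?_, ?_, ?_⟩
  · intro n X
    simpa only [one_mul] using hA n X
  · intro n X u u' h
    simpa only [one_mul] using hLoc n X u u' h
  · intro n
    simpa only [one_mul] using hR n
  · intro n X hX u'
    simpa only [one_mul] using hV n X hX u'
  · intro n X u _
    exact (differentiable_id.mul (differentiable_const _)).differentiableOn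
  · intro z hz n X u hu
    rw [Metric.mem_ball, dist_zero_right] at hz
    show ‖z * P n X u‖ ≤ ρ * Ē * Real.exp (-κ * (S k n).dj X)
    rw [norm_mul]
    calc ‖z‖ * ‖P n X u‖ ≤ (Ē / E) * (ρ * E * Real.exp (-κ * (S k n).dj X)) :=
          mul_le_mul hz.le (hB n X u hu) (norm_nonneg _) (div_nonneg hĒ0 hE.le)
      _ = ρ * Ē * Real.exp (-κ * (S k n).dj X) := by
          field_simp
  · intro n X u _
    exact zero_mul _

/-- **(L♭) and (L) are the same ITEM up to constants** (kernel both ways). -/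
theorem flat_iff_contraction_upTo {γ₀ κ : ℝ} :
    (∃ ρ Ē, 0 ≤ ρ ∧ ρ < 1 ∧ 0 < Ē ∧ DChannelContraction S M m Uc coords χ W Φ Φz ι wrap emb πc γ₀ ρ Ē κ) ↔
    (∃ Ē Ē' C, 0 ≤ C ∧ 0 < Ē ∧ Ē < Ē' ∧ C < Ē' ∧
      DChannelFlat S M m Uc coords χ W Φ Φz ι wrap emb πc γ₀ Ē' C κ ∧
      DChannelContraction S M m Uc coords χ W Φ Φz ι wrap emb πc γ₀ (C / Ē') Ē κ) := by
  constructor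
  · rintro ⟨ρ, Ē, hρ, hρ1, hĒ, hL⟩
    -- restrict (L) from `Ē` to `Ē/2 < Ē`, complexify at scale `Ē`
    refine ⟨Ē / 2, Ē, ρ * Ē, mul_nonneg hρ hĒ.le, by linarith, by linarith, ?_, flat_of_dChannelContraction S M m Uc coords χ W Φ Φz ι wrap emb πc hL, ?_⟩
    · calc ρ * Ē < 1 * Ē := mul_lt_mul_of_pos_right hρ1 hĒ
        _ = Ē := one_mul Ē
    · have hq : ρ * Ē / Ē = ρ := by field_simp
      rw [hq]
      intro k v hv E hE hEĒ hprev
      exact hL k v hv E hE (by linarith) hprev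
  · rintro ⟨Ē, Ē', C, hC, hĒ, hĒĒ, hCĒ, -, hL⟩
    have hĒ' : 0 < Ē' := hĒ.trans hĒĒ
    exact ⟨C / Ē', Ē, div_nonneg hC hĒ'.le, (div_lt_one hĒ').2 hCĒ, hĒ, hL⟩

/-- The glue (twin of v7 `uniformFormat_of_split`, full-memory Grönwall): (Z) with `σ > 0`, (L) with `(ρ, Ē)`, `ρ < 1`, closure
`σ ≤ (1 − ρ)·Ē` ⟹ the wall's body with `E₀ := σ / (1 − ρ)`. -/
theorem uniformFormat_of_split {γ₀ σ ρ Ē κ : ℝ} (hσ : 0 < σ) (hρ1 : ρ < 1) (hcl : σ ≤ (1 - ρ) * Ē)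
    (hZ : ZeroInputFormat S M m Uc coords χ W Φz ι wrap emb πc γ₀ σ κ)
    (hL : DChannelContraction S M m Uc coords χ W Φ Φz ι wrap emb πc γ₀ ρ Ē κ) :
    UniformFormat S M m Uc coords χ W Φ ι wrap emb πc γ₀ (σ / (1 - ρ)) κ := by
  have h1ρ : 0 < 1 - ρ := by linarith
  have hE0 : 0 < σ / (1 - ρ) := div_pos hσ h1ρ
  have hEbar : σ / (1 - ρ) ≤ Ē := by
    rw [div_le_iff₀ h1ρ]
    linarith
  have hne : 1 - ρ ≠ 0 := h1ρ.ne'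
  have hconst : σ + ρ * (σ / (1 - ρ)) = σ / (1 - ρ) := by
    field_simp
    ring
  intro k
  induction k using Nat.strong_induction_on with
  | h k ih =>
    intro v hv
    have hD := hL k v hv (σ / (1 - ρ)) hE0 hEbar (fun j hj w hw => ih j hj w hw)
    have h := formatPlus_of_split (hZ k v hv) hD
    rw [hconst] at h
    exact h

/-- **THE FLAT SPLIT, ITEM-SHAPED**: ONE existential over `(σ, Ē, Ē', C)` with the guards, the closure (print: R23 at scale `Ē'`, §1
`schwarzSlope_le_one_iff`) and the two conjuncts (Z) ∧ (L♭). -/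
def FlatSplitItem (γ₀ κ : ℝ) : Prop :=
  ∃ σ Ē Ē' C : ℝ, 0 < σ ∧ 0 ≤ C ∧ 0 < Ē ∧ Ē < Ē' ∧ C < Ē' ∧ σ ≤ (1 - C / Ē') * Ē ∧
    ZeroInputFormat S M m Uc coords χ W Φz ι wrap emb πc γ₀ σ κ ∧
    DChannelFlat S M m Uc coords χ W Φ Φz ι wrap emb πc γ₀ Ē' C κ

/-- **Flat split ⟹ the wall's item** (`∃ E₀ ≥ 0, UniformFormat … E₀`), with `E₀ := σ / (1 − C/Ē')`. -/
theorem wall_of_flatSplitItem {γ₀ κ : ℝ} (h : FlatSplitItem S M m Uc coords χ W Φ Φz ι wrap emb πc γ₀ κ) :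
    ∃ E₀ : ℝ, 0 ≤ E₀ ∧ UniformFormat S M m Uc coords χ W Φ ι wrap emb πc γ₀ E₀ κ := by
  obtain ⟨σ, Ē, Ē', C, hσ, hC, hĒ, hĒĒ, hCĒ, hcl, hZ, hF⟩ := h
  have hĒ' : 0 < Ē' := hĒ.trans hĒĒ
  have hρ1 : C / Ē' < 1 := by rw [div_lt_one hĒ']; exact hCĒ
  have hL := dChannelContraction_of_flat S M m Uc coords χ W Φ Φz ι wrap emb πc hĒĒ hF
  exact ⟨σ / (1 - C / Ē'), div_nonneg hσ.le (by linarith),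
    uniformFormat_of_split S M m Uc coords χ W Φ Φz ι wrap emb πc hσ hρ1 hcl hZ hL⟩

end Flat

/-! ## §3. Record side: the REAL interpolation of the history through the one step functional (anchor of the `z`-family) -/

section Record

open Literature.MathematicalPhysics.QuantumFieldTheory.Balaban1983to89.Node00
open B12Eq019ActionBody (nextAction)
open T4Continuum (T4Family)

variable (F : T4Family) (N : ℕ) [NeZero N]

/-- Print's MAIN TERM `−(1/g_k²)A(U_k(V))` (twin of DN0 precheck `mainTermT`). [cite: Balaban1987RG1, (1.3) p.260] -/
def mainTermT (ε : ℝ) (K : ℕ) (g : ℕ → ℝ) (k : ℕ) : Density (F.P K) k (SU N) :=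
  fun V => -(1 / (g k) ^ 2) * wilsonAction4 (Uk F N K k ε V)

/-- 𝐄_k := A_k + (1/g_k²)A(U_k) (twin of DN0 precheck `EkT`). [cite: Balaban1987RG1, (0.22) p.256] -/
def EkT (T : Transport F N) (χ : (K : ℕ) → (ℕ → ℝ) → (k : ℕ) → Density (F.P K) k (SU N)) (ε : ℝ) (K : ℕ) (g : ℕ → ℝ)
    (k : ℕ) : Density (F.P K) k (SU N) :=
  fun V => effActionHT F N T χ K g k V + (1 / (g k) ^ 2) * wilsonAction4 (Uk F N K k ε V)

/-- `A_k = A⁰_k + 𝐄_k` as densities. [cite: Balaban1987RG1, (0.22) p.256 (bookkeeping)] -/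
theorem effActionHT_eq_main_add_Ek (T : Transport F N) (χ : (K : ℕ) → (ℕ → ℝ) → (k : ℕ) → Density (F.P K) k (SU N)) (ε : ℝ)
    (K : ℕ) (g : ℕ → ℝ) (k : ℕ) : effActionHT F N T χ K g k = mainTermT F N ε K g k + EkT F N T χ ε K g k := by
  funext V
  show effActionHT F N T χ K g k V = mainTermT F N ε K g k V + EkT F N T χ ε K g k V
  unfold mainTermT EkT
  ring

/-- The ONE-STEP functional of record with EXPLICIT input action `R_k(A)(W) := 𝐓_k(A)(W) − A(Ū^k U_{k+1} W)` (twin of DN0 precheck `stepOutT`).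
[cite: Balaban1987RG1, (0.19) p.255, (1.6) p.261] -/
def stepOutT (T : Transport F N) (χ : (K : ℕ) → (ℕ → ℝ) → (k : ℕ) → Density (F.P K) k (SU N)) (ε : ℝ) (K : ℕ) (g : ℕ → ℝ)
    (k : ℕ) (A : Density (F.P K) k (SU N)) (W : GaugeField (F.P K) (k + 1) (SU N)) : ℝ :=
  nextAction (T K k) (χ K g k) (gfOfRecord F N K k) (g k) A W - A (Averaging.iter (avOfRecord F N K) k (Uk F N K (k + 1) ε W))

/-- **The REAL history interpolation** `t ↦ R_k(A⁰_k + t·𝐄_k)(W)`: the record's step at the history multiplied by a real `t`.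
[cite: Balaban1987RG1, (1.6) p.261 (bookkeeping)] -/
def histInterpT (T : Transport F N) (χ : (K : ℕ) → (ℕ → ℝ) → (k : ℕ) → Density (F.P K) k (SU N)) (ε : ℝ) (K : ℕ)
    (g : ℕ → ℝ) (k : ℕ) (t : ℝ) (W : GaugeField (F.P K) (k + 1) (SU N)) : ℝ :=
  stepOutT F N T χ ε K g k (mainTermT F N ε K g k + t • EkT F N T χ ε K g k) W

/-- At `t = 1` the interpolation IS the merged term 𝓝_{k+1} of record ((1.6)). [cite: Balaban1987RG1, (1.6) p.261 (bookkeeping)] -/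
theorem histInterpT_one (T : Transport F N) (χ : (K : ℕ) → (ℕ → ℝ) → (k : ℕ) → Density (F.P K) k (SU N)) (ε : ℝ) (K : ℕ)
    (g : ℕ → ℝ) (k : ℕ) (W : GaugeField (F.P K) (k + 1) (SU N)) :
    histInterpT F N T χ ε K g k 1 W = mergedTermT F N T χ ε K g k W := by
  unfold histInterpT stepOutT mergedTermT
  rw [one_smul, ← effActionHT_eq_main_add_Ek, effActionHT_succ]

/-- At `t = 0` it is the ZERO-INPUT output 𝓝⁰_{k+1} := R_k(A⁰_k) (DN0 precheck `zeroInputMergedTermT`, there by `rfl`). [cite: Balaban1987RG1, (1.6) p.261 (bookkeeping)] -/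
theorem histInterpT_zero (T : Transport F N) (χ : (K : ℕ) → (ℕ → ℝ) → (k : ℕ) → Density (F.P K) k (SU N)) (ε : ℝ) (K : ℕ)
    (g : ℕ → ℝ) (k : ℕ) (W : GaugeField (F.P K) (k + 1) (SU N)) :
    histInterpT F N T χ ε K g k 0 W = stepOutT F N T χ ε K g k (mainTermT F N ε K g k) W := by
  unfold histInterpT
  rw [zero_smul, add_zero]

/-- **The interpolated HISTORY CHANNEL** `𝓓_{k+1}(t) := R_k(A⁰_k + t·𝐄_k) − R_k(A⁰_k)`. [cite: Balaban1987RG1, (1.6) p.261 (bookkeeping)] -/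
def dChannelInterpT (T : Transport F N) (χ : (K : ℕ) → (ℕ → ℝ) → (k : ℕ) → Density (F.P K) k (SU N)) (ε : ℝ) (K : ℕ)
    (g : ℕ → ℝ) (k : ℕ) (t : ℝ) (W : GaugeField (F.P K) (k + 1) (SU N)) : ℝ :=
  histInterpT F N T χ ε K g k t W - histInterpT F N T χ ε K g k 0 W

/-- It VANISHES at `t = 0` (the `z = 0` anchor of (L♭)). -/
theorem dChannelInterpT_zero (T : Transport F N) (χ : (K : ℕ) → (ℕ → ℝ) → (k : ℕ) → Density (F.P K) k (SU N)) (ε : ℝ)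
    (K : ℕ) (g : ℕ → ℝ) (k : ℕ) (W : GaugeField (F.P K) (k + 1) (SU N)) :
    dChannelInterpT F N T χ ε K g k 0 W = 0 :=
  sub_self _

/-- At `t = 1` it is the history channel `𝓝_{k+1} − 𝓝⁰_{k+1}` of the split (the `z = 1` anchor of (L♭)). -/
theorem dChannelInterpT_one (T : Transport F N) (χ : (K : ℕ) → (ℕ → ℝ) → (k : ℕ) → Density (F.P K) k (SU N)) (ε : ℝ)
    (K : ℕ) (g : ℕ → ℝ) (k : ℕ) (W : GaugeField (F.P K) (k + 1) (SU N)) :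
    dChannelInterpT F N T χ ε K g k 1 W =
      mergedTermT F N T χ ε K g k W - stepOutT F N T χ ε K g k (mainTermT F N ε K g k) W := by
  rw [dChannelInterpT, histInterpT_one, histInterpT_zero]

/-- The input of the interpolation is AFFINE in `t` (so every functional of the input that is analytic in the action is analytic in `t`;
the complex extension `t ↦ z` is what (L♭) quantifies over). -/
theorem histInput_affine (T : Transport F N) (χ : (K : ℕ) → (ℕ → ℝ) → (k : ℕ) → Density (F.P K) k (SU N)) (ε : ℝ) (K : ℕ)
    (g : ℕ → ℝ) (k : ℕ) (s t : ℝ) :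
    mainTermT F N ε K g k + (s + t) • EkT F N T χ ε K g k =
      (mainTermT F N ε K g k + s • EkT F N T χ ε K g k) + t • EkT F N T χ ε K g k := by
  rw [add_smul, add_assoc]

end Record

/-! ## §4. Models: the flat split fires non-vacuously (Toy D); the wall does not inhabit it (Toy A♭) -/

section Toys

/-- One localization domain of tree length `0` (twin of v7). -/
abbrev toyS : ℕ → LocDomainSys := fun _ => { Dom := Unit, dj := fun _ => 0, dj_nonneg := fun _ => le_rfl }
/-- No coordinates. -/
abbrev toyM : ℕ → ℕ := fun _ => 0
/-- The whole coordinate space. -/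
abbrev toyUc : (n : ℕ) → (toyS n).Dom → Set (Fin (toyM n) → ℂ) := fun _ _ => Set.univ
/-- No coordinates «in X». -/
abbrev toyCoords : (n : ℕ) → (toyS n).Dom → Finset (Fin (toyM n)) := fun _ _ => ∅
/-- Chart dimension `0`. -/
abbrev toym : ℕ → ℕ := fun _ => 0
/-- Identity chart. -/
abbrev toyχ : (n : ℕ) → (toyS n).Dom → (Fin (toym n) → ℂ) → (Fin (toyM n) → ℂ) := fun _ _ u => u
/-- `B : ℂ` ↦ the empty coordinate vector. -/
abbrev toyι : (n : ℕ) → ℂ → (Fin (toym n) → ℂ) := fun _ _ => ![]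
/-- No wrapping domains. -/
abbrev toyWrap : (n : ℕ) → Finset (toyS n).Dom := fun _ => ∅
/-- Identity domain embedding. -/
abbrev toyEmb : (n : ℕ) → (toyS n).Dom → (toyS (n + 1)).Dom := fun _ X => X
/-- Identity coordinate projection. -/
abbrev toyπc : (n : ℕ) → (toyS n).Dom → (Fin (toyM (n + 1)) → ℂ) → (Fin (toyM n) → ℂ) := fun _ _ u => u
/-- Constant functional. -/
abbrev constFun (c : ℝ) : (n : ℕ) → ℂ → ℂ := fun _ _ => (c : ℂ)

/-- The mould on the toy data is `|c| ≤ E₀` (twin of v7 `toy_formatPlus_iff`). -/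
theorem toy_formatPlus_iff (c E₀ κ : ℝ) :
    FormatPlus toyS toyM toyUc toyCoords toym toyχ (W := fun _ => ℂ) (constFun c) toyι toyWrap toyEmb toyπc E₀ κ ↔
      |c| ≤ E₀ := by
  constructor
  · rintro ⟨P, -, hB, -, hR, -⟩
    have h0 := (hR 0).self_of_nhds
    rw [Fintype.sum_unique] at h0
    have h2 := hB 0 default (toyχ 0 default (toyι 0 0)) (Set.mem_univ _)
    rw [← h0] at h2
    simpa using h2
  · intro hc
    refine ⟨fun _ _ _ => (c : ℂ), ?_, ?_, ?_, ?_, ?_⟩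
    · intro n X
      exact analyticOnNhd_const
    · intro n X u _
      simpa using hc
    · intro n X u u' _
      rfl
    · intro n
      exact Filter.Eventually.of_forall fun B => by simp
    · intro n X _ u'
      rfl

/-- Level-indexed toy data. -/
abbrev lvS : ℕ → ℕ → LocDomainSys := fun _ => toyS
/-- idem -/
abbrev lvM : ℕ → ℕ → ℕ := fun _ => toyM
/-- idem -/
abbrev lvm : ℕ → ℕ → ℕ := fun _ => toym
/-- idem -/
abbrev lvUc : (k n : ℕ) → (lvS k n).Dom → Set (Fin (lvM k n) → ℂ) := fun _ => toyUc
/-- idem -/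
abbrev lvCoords : (k n : ℕ) → (lvS k n).Dom → Finset (Fin (lvM k n)) := fun _ => toyCoords
/-- idem -/
abbrev lvχ : (k n : ℕ) → (lvS k n).Dom → (Fin (lvm k n) → ℂ) → (Fin (lvM k n) → ℂ) := fun _ => toyχ
/-- idem -/
abbrev lvW : ℕ → ℕ → Type := fun _ _ => ℂ
/-- idem -/
abbrev lvι : (k n : ℕ) → lvW k n → (Fin (lvm k n) → ℂ) := fun _ => toyι
/-- idem -/
abbrev lvWrap : (k n : ℕ) → Finset (lvS k n).Dom := fun _ => toyWrap
/-- idem -/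
abbrev lvEmb : (k n : ℕ) → (lvS k n).Dom → (lvS k (n + 1)).Dom := fun _ => toyEmb
/-- idem -/
abbrev lvπc : (k n : ℕ) → (lvS k n).Dom → (Fin (lvM k (n + 1)) → ℂ) → (Fin (lvM k n) → ℂ) := fun _ => toyπc

/-- The level functional with value `N k` at level `k`. -/
abbrev seqFun (N : ℕ → ℝ) : (k : ℕ) → (Fin (k + 1) → ℝ) → (n : ℕ) → lvW k n → ℂ := fun k _ _ _ => (N k : ℂ)

/-- The mould at level `k` for the sequence functional is `|N k| ≤ E`. -/
theorem lv_formatPlus_iff (N : ℕ → ℝ) (k : ℕ) (v : Fin (k + 1) → ℝ) (E κ : ℝ) :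
    FormatPlus (lvS k) (lvM k) (lvUc k) (lvCoords k) (lvm k) (lvχ k) (seqFun N k v) (lvι k) (lvWrap k) (lvEmb k) (lvπc k)
        E κ ↔ |N k| ≤ E :=
  toy_formatPlus_iff (N k) E κ

/-- A constant admissible history. -/
theorem const_mem_box {γ₀ : ℝ} (hγ : 0 < γ₀) (k : ℕ) : (fun _ => γ₀ : Fin (k + 1) → ℝ) ∈ FlowStep.Box γ₀ k := by
  intro i _
  exact Set.mem_Ioc.2 ⟨hγ, le_rfl⟩

/-- The linear `z`-family of toy piece systems with slope `d`: `Ez z := z·d` (one domain, no coordinates). -/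
abbrev linPieces (d : ℝ) : ℂ → Pieces toyS toyM := fun z _ _ _ => z * (d : ℂ)

/-! ### Toy D: (Z), (L♭), the flat item hold non-vacuously; the chain fires -/

/-- Total sizes: `1` at level `0`, `5/4` after. -/
def ND : ℕ → ℝ := fun k => if k = 0 then 1 else 5 / 4
/-- Zero-input sizes: `1`. -/
def ZD : ℕ → ℝ := fun _ => 1

/-- (Z) for Toy D with `σ = 1`. -/
theorem toyD_zeroInput (γ₀ κ : ℝ) :
    ZeroInputFormat lvS lvM lvm lvUc lvCoords lvχ lvW (seqFun ZD) lvι lvWrap lvEmb lvπc γ₀ 1 κ := by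
  intro k v _
  rw [lv_formatPlus_iff]
  simp [ZD]

/-- **(L♭) for Toy D, NON-VACUOUSLY**: `Ē' = 4`, `C = 1`; at level `0` the response family is `0`; at level `k ≥ 1` it is `z ↦ z/4`,
bounded by `1` on the disc `|z| < 4/E` because the previous-level hypothesis at level `0` forces `E ≥ 1`. -/
theorem toyD_flat {γ₀ : ℝ} (hγ : 0 < γ₀) (κ : ℝ) :
    DChannelFlat lvS lvM lvm lvUc lvCoords lvχ lvW (seqFun ND) (seqFun ZD) lvι lvWrap lvEmb lvπc γ₀ 4 1 κ := by
  intro k v hv E hE hE4 hprev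
  by_cases hk : k = 0
  · subst hk
    refine ⟨linPieces 0, ?_, ?_, ?_, ?_, ?_, ?_, ?_⟩
    · intro n X; exact analyticOnNhd_const
    · intro n X u u' _; rfl
    · intro n; exact Filter.Eventually.of_forall fun B => by simp [seqFun, ND, ZD]
    · intro n X _ u'; rfl
    · intro n X u _; exact (differentiable_id.mul (differentiable_const _)).differentiableOn
    · intro z _ n X u _
      show ‖z * ((0 : ℝ) : ℂ)‖ ≤ 1 * Real.exp (-κ * 0)
      simp
    · intro n X u _; simp
  · have hE1 : 1 ≤ E := by
      have h := hprev 0 (Nat.pos_of_ne_zero hk) (fun _ => γ₀) (const_mem_box hγ 0)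
      rw [lv_formatPlus_iff] at h
      simpa [ND] using h
    refine ⟨linPieces (1 / 4), ?_, ?_, ?_, ?_, ?_, ?_, ?_⟩
    · intro n X; exact analyticOnNhd_const
    · intro n X u u' _; rfl
    · intro n
      exact Filter.Eventually.of_forall fun B => by
        simp [seqFun, ND, ZD, hk]
        norm_num
    · intro n X _ u'; rfl
    · intro n X u _; exact (differentiable_id.mul (differentiable_const _)).differentiableOn
    · intro z hz n X u _
      show ‖z * ((1 / 4 : ℝ) : ℂ)‖ ≤ 1 * Real.exp (-κ * 0)
      rw [Metric.mem_ball, dist_zero_right] at hz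
      have hz4 : ‖z‖ < 4 := by
        have h4E : 4 / E ≤ 4 := by
          rw [div_le_iff₀ hE]; linarith
        exact lt_of_lt_of_le hz h4E
      rw [norm_mul]
      have : ‖((1 / 4 : ℝ) : ℂ)‖ = 1 / 4 := by
        rw [Complex.norm_real]; norm_num
      rw [this]
      simp only [mul_zero, Real.exp_zero, mul_one]
      linarith
    · intro n X u _; simp

/-- The flat item for Toy D: `σ = 1`, `Ē = 2`, `Ē' = 4`, `C = 1` (slope `1/4`, closure `1 ≤ (3/4)·2`). -/
theorem toyD_flatSplitItem {γ₀ : ℝ} (hγ : 0 < γ₀) (κ : ℝ) :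
    FlatSplitItem lvS lvM lvm lvUc lvCoords lvχ lvW (seqFun ND) (seqFun ZD) lvι lvWrap lvEmb lvπc γ₀ κ :=
  ⟨1, 2, 4, 1, one_pos, zero_le_one, two_pos, by norm_num, by norm_num, by norm_num, toyD_zeroInput γ₀ κ, toyD_flat hγ κ⟩

/-- … hence the wall for Toy D, BY THE CHAIN (rule (N): the glue fires on a non-vacuous instance). -/
theorem toyD_wall {γ₀ : ℝ} (hγ : 0 < γ₀) (κ : ℝ) :
    ∃ E₀ : ℝ, 0 ≤ E₀ ∧ UniformFormat lvS lvM lvm lvUc lvCoords lvχ lvW (seqFun ND) lvι lvWrap lvEmb lvπc γ₀ E₀ κ :=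
  wall_of_flatSplitItem lvS lvM lvm lvUc lvCoords lvχ lvW (seqFun ND) (seqFun ZD) lvι lvWrap lvEmb lvπc (toyD_flatSplitItem hγ κ)

/-! ### Toy A♭: the wall and (Z) hold, the flat item FAILS — the wall does not inhabit (L♭) -/

/-- Total sizes: `1` at level `0`, `2` after (v7's Toy A). -/
def NA : ℕ → ℝ := fun k => if k = 0 then 1 else 2
/-- Zero-input sizes: `1`. -/
def ZA : ℕ → ℝ := fun _ => 1

/-- The wall holds for Toy A♭ with `E₀ = 2`. -/
theorem toyA_wall (γ₀ κ : ℝ) : UniformFormat lvS lvM lvm lvUc lvCoords lvχ lvW (seqFun NA) lvι lvWrap lvEmb lvπc γ₀ 2 κ := by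
  intro k v _
  rw [lv_formatPlus_iff]
  by_cases hk : k = 0 <;> simp [NA, hk]

/-- (Z) holds for Toy A♭ with `σ = 1`. -/
theorem toyA_zeroInput (γ₀ κ : ℝ) :
    ZeroInputFormat lvS lvM lvm lvUc lvCoords lvχ lvW (seqFun ZA) lvι lvWrap lvEmb lvπc γ₀ 1 κ := by
  intro k v _
  rw [lv_formatPlus_iff]
  simp [ZA]

/-- **The flat item FAILS for Toy A♭** although the wall and (Z) hold: at level `1` with `E = 1` a response family bounded by `C < Ē'` on
the disc of radius `Ē'` and vanishing at `0` has `|response(1)| ≤ C/Ē' < 1` by Schwarz — but the response is `2 − 1 = 1`. -/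
theorem toyA_not_flatSplitItem {γ₀ : ℝ} (hγ : 0 < γ₀) (κ : ℝ) :
    ¬ FlatSplitItem lvS lvM lvm lvUc lvCoords lvχ lvW (seqFun NA) (seqFun ZA) lvι lvWrap lvEmb lvπc γ₀ κ := by
  rintro ⟨σ, Ē, Ē', C, hσ, hC, hĒ, hĒĒ, hCĒ, hcl, hZ, hF⟩
  have hĒ' : 0 < Ē' := hĒ.trans hĒĒ
  -- (Z) at level 0 forces σ ≥ 1, the closure then forces Ē ≥ 1, hence Ē' > 1
  have hσ1 : 1 ≤ σ := by
    have h := hZ 0 (fun _ => γ₀) (const_mem_box hγ 0)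
    rw [lv_formatPlus_iff] at h
    simpa [ZA] using h
  have hρ0 : 0 ≤ C / Ē' := div_nonneg hC hĒ'.le
  have hĒ1 : 1 ≤ Ē := by nlinarith
  have hĒ'1 : 1 < Ē' := lt_of_le_of_lt hĒ1 hĒĒ
  -- (L♭) at level 1, E = 1 (the level-0 hypothesis |NA 0| = 1 ≤ 1 holds)
  have hprev : ∀ j, j < 1 → ∀ w, w ∈ FlowStep.Box γ₀ j →
      FormatPlus (lvS j) (lvM j) (lvUc j) (lvCoords j) (lvm j) (lvχ j) (seqFun NA j w) (lvι j) (lvWrap j) (lvEmb j)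
        (lvπc j) 1 κ := by
    intro j hj w _
    have hj0 : j = 0 := by omega
    subst hj0
    rw [lv_formatPlus_iff]
    simp [NA]
  obtain ⟨Ez, -, -, hR, -, hd, hb, h0⟩ := hF 1 (fun _ => γ₀) (const_mem_box hγ 1) 1 one_pos hĒ'1 hprev
  have hR1 : 1 < Ē' / 1 := by rw [div_one]; exact hĒ'1
  have hS := bound118_of_schwarz (lvUc 1) Ez hR1 hd hb h0
  -- the represented value at z = 1 is NA 1 − ZA 1 = 1
  have hrep := (hR 0).self_of_nhds
  rw [Fintype.sum_unique] at hrep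
  have hval : Ez 1 0 default (lvχ 1 0 default (lvι 1 0 0)) = 1 := by
    rw [← hrep]
    simp [seqFun, NA, ZA]
    norm_num
  have hb1 := hS 0 default (lvχ 1 0 default (lvι 1 0 0)) (Set.mem_univ _)
  rw [hval, div_one] at hb1
  have hlt : C / Ē' < 1 := by rw [div_lt_one hĒ']; exact hCĒ
  have : (1 : ℝ) ≤ C / Ē' := by simpa using hb1
  linarith

end Toys

/-! ## §5 (gen 6). THE WINDOW — (Z) and (L♭) are the tree's Theorem-3 chain at TWO constants records: the `E₀`-scaling of print's letters

Print fixes ONE format letter `E₀` ((I.1.18)); the tree's constants record `B13.Consts` carries it as a field and every joiner of the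
[II] chain is parametric in the record.  The zero-input split needs the chain at two values of that field and nothing else:
the FLOOR `E_lo` (zero history, `z = 0`: (Z)) and the CAP `Ē'` (history multiplied by `z`, `‖z‖·E ≤ Ē'`: (L♭)).  This section is the
arithmetic of the letters under `E₀ ↦ E'`: (2.18)'s `1/|τ(Y)|` is `E₀`-linear (the τ-radii SHRINK at the cap — the cap is the joiners'
binder `invTau ≤ ½`), R12's `E₀`-clause is a lower bound (the floor is print's `E₀ ≥ C₃/C₁`), the (2.26)-weight picks up one factor
`E'/E₀` per HISTORY vertex, and zero history satisfies Lemma 2's rows at every scale. -/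

section Window

open Literature.MathematicalPhysics.QuantumFieldTheory.Balaban1983to89.TreeLengthTorus (TPt TDom tsys)
open Literature.MathematicalPhysics.QuantumFieldTheory.Balaban1983to89.TreeLengthTorusTransfer (tclosure)
open Literature.MathematicalPhysics.QuantumFieldTheory.Balaban1983to89.B13Lemma3TorusData (TBond)
open Literature.MathematicalPhysics.QuantumFieldTheory.Balaban1983to89.B13Lemma3TorusTerms (weight Z0)
open Literature.MathematicalPhysics.QuantumFieldTheory.Balaban1983to89.B13Bound143 (invTau R12)

@[simp] theorem withE₀_C₁ (c : B13.Consts) (E' : ℝ) : (withE₀ c E').C₁ = c.C₁ := rfl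
@[simp] theorem withE₀_C₂ (c : B13.Consts) (E' : ℝ) : (withE₀ c E').C₂ = c.C₂ := rfl
@[simp] theorem withE₀_C₃ (c : B13.Consts) (E' : ℝ) : (withE₀ c E').C₃ = c.C₃ := rfl
@[simp] theorem withE₀_α₄ (c : B13.Consts) (E' : ℝ) : (withE₀ c E').α₄ = c.α₄ := rfl
@[simp] theorem withE₀_α₆ (c : B13.Consts) (E' : ℝ) : (withE₀ c E').α₆ = c.α₆ := rfl
@[simp] theorem withE₀_M (c : B13.Consts) (E' : ℝ) : (withE₀ c E').M = c.M := rfl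
@[simp] theorem withE₀_q (c : B13.Consts) (E' : ℝ) : (withE₀ c E').q = c.q := rfl
@[simp] theorem withE₀_κ (c : B13.Consts) (E' : ℝ) : (withE₀ c E').κ = c.κ := rfl
@[simp] theorem withE₀_κ₁ (c : B13.Consts) (E' : ℝ) : (withE₀ c E').κ₁ = c.κ₁ := rfl
@[simp] theorem withE₀_δ (c : B13.Consts) (E' : ℝ) : (withE₀ c E').δ = c.δ := rfl

/-- The `E₀`-free factor of (2.18): `1/|τ(Y)| = E₀ · k(d_k(Y))`, `k(d) = ε₁C₁α₄⁻¹M^q e^{C₂κ₁} e^{−(1−3δ)κ d}`. [cite: Balaban1988RG2Cluster, (2.18) p.16] -/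
def invTauKernel (c : B13.Consts) (dd : ℝ) : ℝ :=
  c.ε₁ * c.C₁ * c.α₄⁻¹ * c.M ^ c.q * Real.exp (c.C₂ * c.κ₁) * Real.exp (-(1 - 3 * c.δ) * c.κ * dd)

/-- **(2.18) is `E₀`-LINEAR.** [cite: Balaban1988RG2Cluster, (2.18) p.16] -/
theorem invTau_eq (c : B13.Consts) (dd : ℝ) : invTau c dd = c.E₀ * invTauKernel c dd := by
  unfold invTau invTauKernel; ring

/-- At scale `E'` the τ-radii `|τ(Y)| = (E'·k)⁻¹` shrink by the factor `E₀/E'`. [cite: Balaban1988RG2Cluster, (2.18) p.16] -/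
theorem invTau_withE₀ (c : B13.Consts) (E' dd : ℝ) : invTau (withE₀ c E') dd = E' * invTauKernel c dd := by
  rw [invTau_eq]; rfl

/-- Positivity of the τ-radii is inherited by every positive scale. -/
theorem invTau_withE₀_pos (c : B13.Consts) {E' dd : ℝ} (hE₀ : 0 < c.E₀) (hE' : 0 < E') (h : 0 < invTau c dd) :
    0 < invTau (withE₀ c E') dd := by
  rw [invTau_eq] at h
  rw [invTau_withE₀]
  exact mul_pos hE' (pos_of_mul_pos_right h hE₀.le)

/-- **THE WINDOW's CAP**: the joiners' binder `invTau ≤ ½` (`|τ(Y)| ≥ 2`, needed for the Cauchy circles of (2.14)) at scale `E'` reads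
`E' · k(d_k(Y)) ≤ ½` — the largest history format at which Theorem 3's chain runs is `Ē_max = 1/(2·max_Y k(d_k(Y)))`, of order `α₄/(ε₁C₁M^q e^{C₂κ₁})`. -/
theorem invTau_withE₀_le_half_iff (c : B13.Consts) (E' dd : ℝ) :
    invTau (withE₀ c E') dd ≤ 1 / 2 ↔ E' * invTauKernel c dd ≤ 1 / 2 := by
  rw [invTau_withE₀]

/-- **THE CAP AS ONE INEQUALITY**: `Ē'·ε₁C₁α₄⁻¹M^q e^{C₂κ₁} ≤ ½` gives `|τ(Y)| ≥ 2` at scale `Ē'` for EVERY domain (`k(d)` is largest at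
`d = 0` when `(1 − 3δ)κ ≥ 0`) — the binder `hhalf'` of §6's K6 discharged from a letter of order `Ē' ≲ α₄/(2ε₁C₁M^q e^{C₂κ₁})`.
[this work, on: Balaban1988RG2Cluster, (2.18) p.16] -/
theorem invTau_withE₀_le_half_of_cap (c : B13.Consts) {E' dd : ℝ} (hE' : 0 ≤ E') (hdd : 0 ≤ dd)
    (hδκ : 0 ≤ (1 - 3 * c.δ) * c.κ) (hk : 0 ≤ c.ε₁ * c.C₁ * c.α₄⁻¹ * c.M ^ c.q)
    (hcap : E' * (c.ε₁ * c.C₁ * c.α₄⁻¹ * c.M ^ c.q * Real.exp (c.C₂ * c.κ₁)) ≤ 1 / 2) :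
    invTau (withE₀ c E') dd ≤ 1 / 2 := by
  rw [invTau_withE₀]
  refine le_trans (mul_le_mul_of_nonneg_left ?_ hE') hcap
  unfold invTauKernel
  have h1 : Real.exp (-(1 - 3 * c.δ) * c.κ * dd) ≤ 1 :=
    calc Real.exp (-(1 - 3 * c.δ) * c.κ * dd) ≤ Real.exp 0 := Real.exp_le_exp.mpr (by nlinarith [mul_nonneg hδκ hdd])
      _ = 1 := Real.exp_zero
  calc c.ε₁ * c.C₁ * c.α₄⁻¹ * c.M ^ c.q * Real.exp (c.C₂ * c.κ₁) * Real.exp (-(1 - 3 * c.δ) * c.κ * dd)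
      ≤ c.ε₁ * c.C₁ * c.α₄⁻¹ * c.M ^ c.q * Real.exp (c.C₂ * c.κ₁) * 1 :=
        mul_le_mul_of_nonneg_left h1 (mul_nonneg hk (Real.exp_nonneg _))
    _ = c.ε₁ * c.C₁ * c.α₄⁻¹ * c.M ^ c.q * Real.exp (c.C₂ * c.κ₁) := mul_one _

/-- **THE WINDOW's FLOOR**: R12 (`⅛(κ₁ − 1) ≥ (1 − 3δ)κ`, `C₃ ≤ E₀C₁`, `q ≥ 8`, p. 16) is MONOTONE in the format — its `E₀`-clause is a
LOWER bound; the chain's restriction at scale `E₀` gives it at every `E' ≥ E₀`. [cite: Balaban1988RG2Cluster, p.16 (after (2.18))] -/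
theorem R12_withE₀ (c : B13.Consts) {E' : ℝ} (h12 : R12 c) (hC₁ : 0 ≤ c.C₁) (hE : c.E₀ ≤ E') : R12 (withE₀ c E') := by
  obtain ⟨h₁, h₂, h₃⟩ := h12
  refine ⟨h₁, ?_, h₃⟩
  show c.C₃ ≤ E' * c.C₁
  exact h₂.trans (mul_le_mul_of_nonneg_right hE hC₁)

/-- **THE (2.26)-WEIGHT AT SCALE `E'`** = the scale-`E₀` weight × `(E'/E₀)^{|𝐃|}`: ONE factor of the format ratio per HISTORY VERTEX
`Y ∈ 𝐃` (`ε₂ = E₀ε₁K₀` per vertex in `B13Lemma3TorusTerms.weight`); terms WITHOUT history vertices are scale-free.  (So the `z`-uniform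
per-term bound on the disc `‖z‖ ≤ Ē'/E₀` grows like `(Ē'/E₀)^{|𝐃|}`, as it must for a function of `z` entering once per vertex; the
resummed (2.38) absorbs it because `ε₂(Ē')` still meets its cap.) [cite: Balaban1988RG2Cluster, (2.26) p.17, ε₂ p.19] -/
theorem weight_withE₀ {d L N' M : ℕ} [NeZero L] [NeZero N'] (c : B13.Consts) (hE₀ : c.E₀ ≠ 0) (E' : ℝ)
    (Z : TDom d N') (a : ℝ) (t : Finset (TDom d (L * N')) × Finset (TBond d M (L * N'))) :
    weight L M (withE₀ c E') Z a t = (E' / c.E₀) ^ t.1.card * weight L M c Z a t := by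
  unfold weight
  have h1 : ∀ Y ∈ t.1, (withE₀ c E').α₆ * (withE₀ c E').eps2 *
        Real.exp (-((1 - 3 * (withE₀ c E').δ) * (withE₀ c E').κ * (tsys d (L * N')).dj Y)) =
      (E' / c.E₀) * (c.α₆ * c.eps2 * Real.exp (-((1 - 3 * c.δ) * c.κ * (tsys d (L * N')).dj Y))) := by
    intro Y _
    rw [eps2_withE₀, withE₀_α₆, withE₀_δ, withE₀_κ, B13.Consts.eps2]
    field_simp
  rw [Finset.prod_congr rfl h1, Finset.prod_mul_distrib, Finset.prod_const, withE₀_κ₁]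
  ring

/-- **ZERO HISTORY satisfies Lemma 2's typed rows AT EVERY SCALE `E' ≥ 0`** (the multiplier `z = 0` in §1 `lemma2Printed_histMul`:
`‖0‖·E₀ = 0 ≤ E'`): the input of (Z) — the zero-input functional `𝓝⁰_{k+1} = R_k(A⁰_k + 0·𝐄_k)` — is an instance of the SAME carrier
predicates at the window's floor. [cite: Balaban1988RG2Cluster, Lemma 2 p.11] -/
theorem lemma2Printed_zeroHistory (S : B13.StepData) (c : B13.Consts) {E' : ℝ} (hE' : 0 ≤ E')
    (h1 : B13.Lemma1Printed S c) (hVpp : S.Vpp = S.Vp) (h2 : B13.Lemma2Printed S c)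
    (hε : 0 ≤ c.ε₁) (hC : 0 ≤ c.C₁) (hM : 0 ≤ c.M ^ c.q)
    (hAadd : ∀ (f g : S.Φ → ℂ) (s : Set S.Φ) (w : ℂ), S.Analytic f s → S.Analytic g s →
      S.Analytic (fun φ => f φ + w * g φ) s)
    (hGsmul : ∀ (f : S.Φ → ℂ) (w : ℂ), S.GaugeInv f → S.GaugeInv (fun φ => w * f φ))
    (hGadd : ∀ (f g : S.Φ → ℂ) (w : ℂ), S.GaugeInv f → S.GaugeInv g → S.GaugeInv (fun φ => f φ + w * g φ)) :
    B13.Lemma2Printed (histMul S 0) (withE₀ c E') :=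
  lemma2Printed_histMul S c 0 h1 hVpp h2 (by simpa using hE') hε hC hM hAadd hGsmul hGadd

/-- … and its history image IS zero. -/
theorem histMul_zero_Vpp (S : B13.StepData) : (histMul S 0).Vpp = fun _ _ => 0 := by
  funext Y φ
  exact zero_mul _

end Window

/-! ## §6 (gen 6). K6 IN KERNEL — the tree's deepest V-joint is INVARIANT under the complex history multiplier

CRIT-1's named M-leaf for (L) via (L♭) was "K6 `h226_histMul`".  The tree's deepest theorem consuming Lemma 2's rows —
(2.26) for ONE term of (2.14) from the primitive random-walk kernels with the analyticity slots DERIVED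
(`B13Lemma3TorusBindersHolo.h226_torus_of_primitives_of_lemma2_holo`, ✓) — is stated for an arbitrary constants record and an
arbitrary two-torus step record.  Feeding it the MULTIPLIED record `twoTorusHistMul W z` (history channel `× z`) at the CAP record
`withE₀ c Ē'` (`‖z‖E₀ ≤ Ē'`) is a by-name instance: Lemma 2's rows transfer by §1's U-c lemmas (`bound136_histMul`: (1.36) at scale
`Ē'`; (1.42)/(1.43) are history-blind), R12 and the τ-radii by §5, and EVERY kernel letter (`hG … hdE`, `hsmallKθ`, `hαc`, `hsmall`,
`hvol`: they mention `α₄, M, κ₁, γ₂`, never `E₀`) is UNCHANGED.  Price, honestly: exactly ONE binder moves — `|τ(Y)| ≥ 2` is asked at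
the cap (`hhalf'`), i.e. the window's cap letter `Ē'·k(d_k(Y)) ≤ ½` of §5; and the conclusion's weight is the scale-`Ē'` weight
(`= (Ē'/E₀)^{|𝐃|} ×` the scale-`E₀` weight, §5 `weight_withE₀`). -/

section K6

open Literature.MathematicalPhysics.QuantumFieldTheory.Balaban1983to89.TreeLengthTorus (TPt TDom tsys)
open Literature.MathematicalPhysics.QuantumFieldTheory.Balaban1983to89.TreeLengthTorusTransfer (tclosure)
open Literature.MathematicalPhysics.QuantumFieldTheory.Balaban1983to89.B13Lemma3TorusData (TBond)
open Literature.MathematicalPhysics.QuantumFieldTheory.Balaban1983to89.B13Lemma3TorusTerms (weight Z0)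
open Literature.MathematicalPhysics.QuantumFieldTheory.Balaban1983to89.B13Bound143 (invTau R12)
open Literature.MathematicalPhysics.QuantumFieldTheory.Balaban1983to89.B13Lemma3Torus (TwoTorusStep)
open Literature.MathematicalPhysics.QuantumFieldTheory.Balaban1983to89.B5TorusCover (UT)
open Literature.MathematicalPhysics.QuantumFieldTheory.Balaban1983to89.B9Thm37GlueTorus (tdist1)
open Literature.MathematicalPhysics.QuantumFieldTheory.Balaban1983to89.B12TreeDecay (K₀)
open Literature.MathematicalPhysics.QuantumFieldTheory.Balaban1983to89.B13Term214 (term214 SepHolOn core214 F214)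
open Literature.MathematicalPhysics.QuantumFieldTheory.Balaban1983to89.B13Lemma3TorusBindersHolo
  (h226_torus_of_primitives_of_lemma2_holo)
open Matrix

/-- (1.42) is HISTORY-BLIND: `V = V_q + V″` survives the multiplier as `V + (z−1)V″ = V_q + zV″`. [cite: Balaban1988RG2Cluster, (1.42) p.11] -/
theorem repr142_histMul (S : B13.StepData) (z : ℂ) (h : B13.Repr142 S) : B13.Repr142 (histMul S z) := by
  intro Y φ hφ
  show S.V Y φ + (z - 1) * S.Vpp Y φ = S.quadForm Y φ + z * S.Vpp Y φ
  rw [h Y φ hφ]; ring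

/-- (1.43) is HISTORY-BLIND and `E₀`-FREE (it bounds the quadratic form of the CURRENT action, Lemma 2 p.11 / (1.40) p.10 with the
absolute constant `C₃`): it holds for the multiplied record at every scale. [cite: Balaban1988RG2Cluster, (1.43) p.11, (1.39)–(1.40) p.10] -/
theorem bound143_histMul (S : B13.StepData) (c : B13.Consts) (z : ℂ) (E' : ℝ) (h : B13.Bound143 S c) :
    B13.Bound143 (histMul S z) (withE₀ c E') := fun Y φ b b' hφ => h Y φ b b' hφ

/-- **The two-torus step record with its HISTORY CHANNEL multiplied by `z`** (`𝓔⁽ᵏ⁾ ↦ z·𝓔⁽ᵏ⁾`: `V″ ↦ zV″`, `V = V_q + V″ ↦ V_q + zV″`;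
domains, fields, bonds, `Q`, spaces, gauge data untouched). [this work; cite: Balaban1988RG2Cluster, (1.41)–(1.42) p.11] -/
def twoTorusHistMul {d L N' : ℕ} [NeZero L] [NeZero N'] (W : TwoTorusStep d L N') (z : ℂ) : TwoTorusStep d L N' :=
  { W with
    Vp := fun Y φ => z * W.Vp Y φ
    Vpp := fun Y φ => z * W.Vpp Y φ
    V := fun Y φ => W.V Y φ + (z - 1) * W.Vpp Y φ }

variable {L N' : ℕ} [NeZero L] [NeZero N'] {M : ℕ}
variable {ν : ℕ} {Nf : Fin ν → ℕ} [∀ i, NeZero (Nf i)]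
variable {Λ : Type} [Fintype Λ] [DecidableEq Λ] {C₀ : Type} [Fintype C₀] [DecidableEq C₀]

/-- Its abstract step data IS §1's `histMul` of the abstract step data — definitionally. -/
theorem toStepData_twoTorusHistMul (W : TwoTorusStep 4 L N') (z : ℂ) :
    (twoTorusHistMul W z).toStepData = histMul W.toStepData z := rfl

open Classical in
/-- **K6 (CRIT-1's named leaf) IN KERNEL: (2.26) for one term of (2.14) OF THE MULTIPLIED RECORD, from the primitive kernels + Lemma 2 of
the UNMULTIPLIED record, holomorphy derived — at the window's cap.**  Binders = those of
`B13Lemma3TorusBindersHolo.h226_torus_of_primitives_of_lemma2_holo` VERBATIM (Lemma 2's rows `hrepr h143 h136` and all letters at the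
record's OWN constants `c`), plus: the cap `Ē' ≥ E₀` (`hEE`), the multiplier `z` with `‖z‖E₀ ≤ Ē'` (`hz`), the history part of the
potentials in the bond variables `Vh` agreeing with `V″` inside the small fields (`hVh`, measurable `hVhm`), and `|τ(Y)| ≥ 2` AT THE CAP
(`hhalf'`, replacing `hhalf`).  Conclusion: the printed (2.26) for the term with potentials `V + (z − 1)V_h` (= `V_q + zV″` inside the
small fields), weight at scale `Ē'`.  Proof: ONE application of the tree theorem to `(withE₀ c Ē', twoTorusHistMul W z)`.
[this work, on: Balaban1988RG2Cluster, Lemma 3 (2.26) p.17, (2.14)–(2.25) pp.15–17, Lemma 2 p.11] -/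
theorem h226_holo_histMul (c : B13.Consts) (hκ₁1 : 1 ≤ c.κ₁) (hα₆ : c.α₆ ≠ 0)
    -- NEW (gen 6): the window's CAP `Ē'` above the record's format and the complex HISTORY MULTIPLIER `z`, `‖z‖·E₀ ≤ Ē'`
    {Ē' : ℝ} (hEE : c.E₀ ≤ Ē') (z : ℂ) (hz : ‖z‖ * c.E₀ ≤ Ē')
    -- Lemma 2 of the record at the torus step, and the numbers of (2.18)–(2.20)
    (W : TwoTorusStep 4 L N') (hrepr : B13.Repr142 W.toStepData) (h143 : B13.Bound143 W.toStepData c)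
    (h136 : B13.Bound136 W.toStepData c W.Vpp) (hvolk : ∀ Y, W.volk Y = Y.1.card)
    (h12 : R12 c) (hC₃ : 0 ≤ c.C₃) (hE : 0 < c.E₀) (hε : 0 < c.ε₁) (hC₁ : 0 < c.C₁) (hα : 0 < c.α₄)
    (hM : 1 ≤ c.M) (hκ₁ : 1 + 4 * Real.log 162 ≤ c.κ₁) (hδκ : 64 * Real.log 162 ≤ c.δ * c.κ)
    (Z : TDom 4 N') (t : Finset (TDom 4 (L * N')) × Finset (TBond 4 M (L * N')))
    (hpos : ∀ Y : TDom 4 (L * N'), 0 < invTau c ((tsys 4 (L * N')).dj Y))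
    -- CHANGED (gen 6): `|τ(Y)| ≥ 2` is asked AT THE CAP (the τ-radii shrink by `E₀/Ē'`, §5 `invTau_withE₀`) — the window's cap letter
    (hhalf' : ∀ Y : TDom 4 (L * N'), invTau (withE₀ c Ē') ((tsys 4 (L * N')).dj Y) ≤ 1 / 2)
    -- the bigger σ-polydisc (a second constants record lending its `κ₁`) and a Cauchy radius `r ≤ 1`; the τ-regions are
    -- the open discs of radii `2|τ(Y)|` (chosen inside; no `Uτ`, `hUtau`, `hsubτ` binders)
    (cp : B13.Consts) (hκp : c.κ₁ < cp.κ₁) {r : ℝ} (hr : 0 < r) (hr1 : r ≤ 1)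
    (lZ : List (TPt 4 N')) (hlZ : lZ.Nodup ∧ lZ.toFinset = Z.1 \ tclosure L N' (Z0 M t))
    (lD : List (TDom 4 (L * N'))) (hlD : lD.Nodup ∧ lD.toFinset = t.1)
    (A : (TPt 4 N' → ℂ) → Matrix Λ Λ ℂ) (Γ : (TPt 4 N' → ℂ) → (Λ ⊕ C₀ → ℝ) → (Λ → ℂ))
    -- the (2.3) characteristic functions: χ_{Y₀} ∈ [0,1] supported on the small fields, χᶜ_P = Π indicators
    (χY₀ χcP : (Λ → ℝ) → ℝ) (hχ0 : ∀ B, 0 ≤ χY₀ B) (hχ1 : ∀ B, χY₀ B ≤ 1)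
    (P : Finset Λ) (hPcard : P.card = t.2.card) {rP : ℝ} (hrP : 0 ≤ rP)
    (hχc : ∀ B, χcP B = ∏ b ∈ P, (if rP ≤ |B b| then (1 : ℝ) else 0))
    (Dfam : Finset (TDom 4 (L * N'))) (V : TDom 4 (L * N') → (Λ → ℝ) → ℂ)
    -- NEW (gen 6): the HISTORY part of the potentials in the bond variables (print's `V″(Y, B̃)` of (1.42))
    (Vh : TDom 4 (L * N') → (Λ → ℝ) → ℂ)
    -- the record's objects behind the term: bonds, cubes, the real field inside the configurations, the potentials
    (ι : Λ → W.Bond) (hι : Function.Injective ι) (cube : W.Bond → TPt 4 (L * N'))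
    (hQsupp : ∀ (Y : TDom 4 (L * N')) φ b b', W.Q Y φ b b' ≠ 0 → cube b ∈ Y.1 ∧ cube b' ∈ Y.1)
    {m' : ℕ} (hfibc : ∀ a : TPt 4 (L * N'), (Finset.univ.filter fun j => cube (ι j) = a).card ≤ m')
    (emb : (Λ → ℝ) → W.Φ) (hBv : ∀ B b, W.Bv (emb B) (ι b) = (B b : ℂ))
    (hBv0 : ∀ B b', b' ∉ Set.range ι → W.Bv (emb B) b' = 0)
    (hV : ∀ Y ∈ Dfam, ∀ B, emb B ∈ W.sp1 Y → V Y B = W.V Y (emb B))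
    (hVh : ∀ Y ∈ Dfam, ∀ B, emb B ∈ W.sp1 Y → Vh Y B = W.Vpp Y (emb B))
    (hχsupp : ∀ B, χY₀ B ≠ 0 → ∀ Y ∈ Dfam, emb B ∈ W.sp1 Y)
    -- REPLACES the separate analyticity `hΨσ ∕ hΨτ`: entrywise σ-holomorphy of `A(σ)` on the OPEN `e^{κ₁⁺}`-polydisc,
    -- measurability of `χ_{k,Y₀}`, of the potentials and of the small-field region in the bond variables
    (hAhol : ∀ i j, DifferentiableOn ℂ (fun σ => A σ i j)
      {σ : TPt 4 N' → ℂ | ∀ j, σ j ∈ Metric.ball (0 : ℂ) (Real.exp cp.κ₁)})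
    (hχm : Measurable χY₀) (hVm : ∀ Y, Measurable (V Y)) (hVhm : ∀ Y, Measurable (Vh Y))
    (hsmallm : MeasurableSet {B : Λ → ℝ | ∀ Y ∈ Dfam, emb B ∈ W.sp1 Y})
    {C : Matrix Λ Λ ℝ} (hC : C.PosDef) (Γ₀ : Matrix Λ (Λ ⊕ C₀) ℝ)
    (hAs : ∀ σ : TPt 4 N' → ℂ, (∀ j, ‖σ j‖ ≤ Real.exp cp.κ₁) → (A σ).IsSymm)
    (hA : ∀ σ : TPt 4 N' → ℂ, (∀ j, ‖σ j‖ ≤ Real.exp cp.κ₁) → ((A σ).map Complex.re).PosDef)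
    (G : (TPt 4 N' → ℂ) → Matrix Λ (Λ ⊕ C₀) ℂ)
    (hlin : ∀ σ : TPt 4 N' → ℂ, (∀ j, ‖σ j‖ ≤ Real.exp cp.κ₁) →
      ∀ X : Λ ⊕ C₀ → ℝ, Γ σ X = G σ *ᵥ fun j => (X j : ℂ))
    (hGhol : ∀ i j, DifferentiableOn ℂ (fun σ => G σ i j)
      {σ : TPt 4 N' → ℂ | ∀ j, σ j ∈ Metric.ball (0 : ℂ) (Real.exp cp.κ₁)})
    {γ₂ : ℝ} (hγ₂ : 0 ≤ γ₂)
    -- bonds located on the torus `UT Nf` (for the kernel letters)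
    (locΛ : Λ → UT Nf) (locN : Λ ⊕ C₀ → UT Nf) {m : ℕ}
    (hfibΛ : ∀ x : UT Nf, (Finset.univ.filter fun i => locΛ i = x).card ≤ m)
    (hfibN : ∀ x : UT Nf, (Finset.univ.filter fun j => locN j = x).card ≤ m)
    -- rates and constants
    {kap kap' kap'' θ θE θΓ θC KG KΓ KCs K₀' : ℝ} (hkap'' : 0 < kap'') (h1 : kap'' < kap') (h2 : kap' < kap)
    (hθE : 0 ≤ θE) (hθΓ : 0 ≤ θΓ) (hθC : 0 ≤ θC) (hKG : 0 ≤ KG) (hKΓ : 0 ≤ KΓ) (hKCs : 0 ≤ KCs) (hK₀ : 0 ≤ K₀')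
    (hθEle : θE ≤ θ) (hθΓle : θΓ ≤ θ)
    (hθR1le : (m * (1 + 2 / (kap - kap')) ^ ν) * (m * (1 + 2 / (kap' - kap'')) ^ ν)
      * (θΓ * KCs * KG + KΓ * θC * KG + KΓ * K₀' * θΓ) ≤ θ)
    -- uniform localisation of the primitive kernels in the torus distance (L17a)
    (hG : ∀ σ : TPt 4 N' → ℂ, (∀ j, ‖σ j‖ ≤ Real.exp cp.κ₁) →
      ∀ b j, ‖G σ b j‖ ≤ KG * Real.exp (-(kap * tdist1 Nf (locΛ b) (locN j))))
    (hΓ₀ : ∀ b j, ‖Γ₀ b j‖ ≤ KΓ * Real.exp (-(kap * tdist1 Nf (locΛ b) (locN j))))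
    (hCs : ∀ σ : TPt 4 N' → ℂ, (∀ j, ‖σ j‖ ≤ Real.exp cp.κ₁) →
      ∀ b b', ‖(A σ)⁻¹ b b'‖ ≤ KCs * Real.exp (-(kap * tdist1 Nf (locΛ b) (locΛ b'))))
    (hC216 : ∀ b b', ‖C b b'‖ ≤ K₀' * Real.exp (-(kap * tdist1 Nf (locΛ b) (locΛ b'))))
    -- the (2.16)-type differences of the primitive kernels in the torus distance (L16a)
    (hdΓ : ∀ σ : TPt 4 N' → ℂ, (∀ j, ‖σ j‖ ≤ Real.exp cp.κ₁) →
      ∀ b j, ‖(G σ - Γ₀.map (algebraMap ℝ ℂ)) b j‖ ≤ θΓ * Real.exp (-(kap * tdist1 Nf (locΛ b) (locN j))))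
    (hdC : ∀ σ : TPt 4 N' → ℂ, (∀ j, ‖σ j‖ ≤ Real.exp cp.κ₁) →
      ∀ b b', ‖((A σ)⁻¹ - C.map (algebraMap ℝ ℂ)) b b'‖
        ≤ θC * Real.exp (-(kap * tdist1 Nf (locΛ b) (locΛ b'))))
    (hdE : ∀ σ : TPt 4 N' → ℂ, (∀ j, ‖σ j‖ ≤ Real.exp cp.κ₁) →
      ∀ b b', ‖(A σ - C⁻¹.map (algebraMap ℝ ℂ)) b b'‖ ≤ θE * Real.exp (-(kap * tdist1 Nf (locΛ b) (locΛ b'))))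
    (hsmallKθ : K₀' * (m * (1 + 2 / kap) ^ ν) * (θ * (m * (1 + 2 / kap'') ^ ν)) < 1)
    -- the (2.24)–(2.25) smallness, with `a₂₀ = 2·m′·α₄·M⁻⁴(1 + 32/(κ₁−1))⁴` (the factor 2 = the τ-region's radius ratio)
    {cE g : ℝ} (hc0 : 0 ≤ cE) (hc : ∀ k, hC.1.eigenvalues k ≤ cE)
    (hαc : (2 * (θ * (m * (1 + 2 / kap'') ^ ν)) +
      (γ₂ + 2 * (m' * c.α₄ * (c.M ^ 4)⁻¹ * (1 + 32 / (c.κ₁ - 1)) ^ 4))) * cE ≤ 1 / 2) (hg : 0 ≤ g)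
    (hΓq : ∀ X : Λ ⊕ C₀ → ℝ, (Γ₀ *ᵥ X) ⬝ᵥ (C *ᵥ (Γ₀ *ᵥ X)) ≤ g * (X ⬝ᵥ X))
    (hsmall : (2 * (θ * (m * (1 + 2 / kap'') ^ ν)) +
      (γ₂ + 2 * (m' * c.α₄ * (c.M ^ 4)⁻¹ * (1 + 32 / (c.κ₁ - 1)) ^ 4))) * (1 + 2 * cE * g) ≤ 1 / 2)
    -- constant matching, p. 17, with `w = 2·K₀(64,8)·α₄·#(⋃𝐃)`
    {a a₅ : ℝ} (hPa : a ≤ γ₂ * rP ^ 2)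
    (hvol : 2 * (K₀' * (m * (1 + 2 / kap) ^ ν) * (θ * (m * (1 + 2 / kap'') ^ ν))
              * (1 + (1 - K₀' * (m * (1 + 2 / kap) ^ ν) * (θ * (m * (1 + 2 / kap'') ^ ν)))⁻¹) / 2)
          * (Fintype.card Λ : ℝ)
        + 2 * (K₀ 64 8 * c.α₄ * (((Dfam.image Subtype.val).biUnion id).card : ℝ))
        + (2 * (θ * (m * (1 + 2 / kap'') ^ ν)) +
            (γ₂ + 2 * (m' * c.α₄ * (c.M ^ 4)⁻¹ * (1 + 32 / (c.κ₁ - 1)) ^ 4))) * cE * (Fintype.card Λ : ℝ)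
        + (2 * (θ * (m * (1 + 2 / kap'') ^ ν)) +
            (γ₂ + 2 * (m' * c.α₄ * (c.M ^ 4)⁻¹ * (1 + 32 / (c.κ₁ - 1)) ^ 4))) * (1 + 2 * cE * g)
            * (Fintype.card (Λ ⊕ C₀) : ℝ)
        ≤ a₅ * ((Z.1).card : ℝ)) :
    ‖term214 r lZ lD (core214 A Γ (F214 t.2.card χY₀ χcP Dfam (fun Y B => V Y B + (z - 1) * Vh Y B))) 0 0‖ ≤
      weight L M (withE₀ c Ē') Z a t * Real.exp (a₅ * ((Z.1).card : ℝ)) := by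
  have hE' : 0 < Ē' := hE.trans_le hEE
  have hMq : 0 ≤ c.M ^ c.q := pow_nonneg (by linarith) _
  have h12' : R12 (withE₀ c Ē') := R12_withE₀ c h12 hC₁.le hEE
  have hpos' : ∀ Y : TDom 4 (L * N'), 0 < invTau (withE₀ c Ē') ((tsys 4 (L * N')).dj Y) :=
    fun Y => invTau_withE₀_pos c hE hE' (hpos Y)
  -- Lemma 2's rows for the multiplied record at the cap (§1 U-c, transported to the two-torus step data by `rfl`)
  have hrepr' : B13.Repr142 (twoTorusHistMul W z).toStepData := by
    rw [toStepData_twoTorusHistMul]; exact repr142_histMul W.toStepData z hrepr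
  have h143' : B13.Bound143 (twoTorusHistMul W z).toStepData (withE₀ c Ē') := by
    rw [toStepData_twoTorusHistMul]; exact bound143_histMul W.toStepData c z Ē' h143
  have h136' : B13.Bound136 (twoTorusHistMul W z).toStepData (withE₀ c Ē') (twoTorusHistMul W z).Vpp :=
    bound136_histMul W.toStepData c W.Vpp z h136 hz hε.le hC₁.le hMq
  -- the multiplied potentials in the bond variables: `V + (z − 1)·V_h = (V_q + V″) + (z − 1)V″ = V_q + z·V″` inside the small fields
  have hV' : ∀ Y ∈ Dfam, ∀ B, emb B ∈ (twoTorusHistMul W z).sp1 Y →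
      V Y B + (z - 1) * Vh Y B = (twoTorusHistMul W z).V Y (emb B) := by
    intro Y hY B hB
    show V Y B + (z - 1) * Vh Y B = W.V Y (emb B) + (z - 1) * W.Vpp Y (emb B)
    rw [hV Y hY B hB, hVh Y hY B hB]
  have hVm' : ∀ Y, Measurable fun B => V Y B + (z - 1) * Vh Y B :=
    fun Y => (hVm Y).add ((hVhm Y).const_mul (z - 1))
  exact h226_torus_of_primitives_of_lemma2_holo (withE₀ c Ē') hκ₁1 hα₆ (twoTorusHistMul W z) hrepr' h143' h136' hvolk
    h12' hC₃ hE' hε hC₁ hα hM hκ₁ hδκ Z t hpos' hhalf' cp hκp hr hr1 lZ hlZ lD hlD A Γ χY₀ χcP hχ0 hχ1 P hPcard hrP hχc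
    Dfam (fun Y B => V Y B + (z - 1) * Vh Y B) ι hι cube hQsupp hfibc emb hBv hBv0 hV' hχsupp hAhol hχm hVm' hsmallm hC Γ₀
    hAs hA G hlin hGhol hγ₂ locΛ locN hfibΛ hfibN hkap'' h1 h2 hθE hθΓ hθC hKG hKΓ hKCs hK₀ hθEle hθΓle hθR1le hG hΓ₀ hCs
    hC216 hdΓ hdC hdE hsmallKθ hc0 hc hαc hg hΓq hsmall hPa hvol


open Classical in
/-- **K6₀ — THE (Z) EDGE: (2.26) for one term of (2.14) OF THE ZERO-HISTORY RECORD, at the window's FLOOR.**  CRIT-1's "(Z) with its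
`𝐃 = ∅` S/M variant" needs NO variant theorem: it is the same tree theorem applied to `twoTorusHistMul W 0` (history channel × 0) at the
record's own constants — read with `c.E₀` = the floor format `E_lo` (any `E_lo` meeting R12's `C₃ ≤ E_lo·C₁`, which is what keeps (2.20)
valid on the LARGER τ-circles of a smaller format) — with Lemma 2's (1.36) row DISCHARGED (`‖0·V″‖ = 0`), (1.42)/(1.43) history-blind.
Binders = the tree theorem's minus `h136`, plus `Vh`/`hVh`/`hVhm` (the history part, subtracted in the bond variables: potentials `V − V_h
= V_q` inside the small fields).  [this work, on: Balaban1988RG2Cluster, Lemma 3 (2.26) p.17, Lemma 2 p.11, R12 p.16] -/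
theorem h226_holo_zeroHistory (c : B13.Consts) (hκ₁1 : 1 ≤ c.κ₁) (hα₆ : c.α₆ ≠ 0)
    -- Lemma 2 of the record at the torus step, and the numbers of (2.18)–(2.20)
    (W : TwoTorusStep 4 L N') (hrepr : B13.Repr142 W.toStepData) (h143 : B13.Bound143 W.toStepData c)
    -- CHANGED (gen 6): NO (1.36) row `h136` — the history is ZERO; the record `c` is read AT THE FLOOR (its `E₀` is the floor format)
    (hvolk : ∀ Y, W.volk Y = Y.1.card)
    (h12 : R12 c) (hC₃ : 0 ≤ c.C₃) (hE : 0 < c.E₀) (hε : 0 < c.ε₁) (hC₁ : 0 < c.C₁) (hα : 0 < c.α₄)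
    (hM : 1 ≤ c.M) (hκ₁ : 1 + 4 * Real.log 162 ≤ c.κ₁) (hδκ : 64 * Real.log 162 ≤ c.δ * c.κ)
    (Z : TDom 4 N') (t : Finset (TDom 4 (L * N')) × Finset (TBond 4 M (L * N')))
    (hpos : ∀ Y : TDom 4 (L * N'), 0 < invTau c ((tsys 4 (L * N')).dj Y))
    (hhalf : ∀ Y : TDom 4 (L * N'), invTau c ((tsys 4 (L * N')).dj Y) ≤ 1 / 2)
    -- the bigger σ-polydisc (a second constants record lending its `κ₁`) and a Cauchy radius `r ≤ 1`; the τ-regions are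
    -- the open discs of radii `2|τ(Y)|` (chosen inside; no `Uτ`, `hUtau`, `hsubτ` binders)
    (cp : B13.Consts) (hκp : c.κ₁ < cp.κ₁) {r : ℝ} (hr : 0 < r) (hr1 : r ≤ 1)
    (lZ : List (TPt 4 N')) (hlZ : lZ.Nodup ∧ lZ.toFinset = Z.1 \ tclosure L N' (Z0 M t))
    (lD : List (TDom 4 (L * N'))) (hlD : lD.Nodup ∧ lD.toFinset = t.1)
    (A : (TPt 4 N' → ℂ) → Matrix Λ Λ ℂ) (Γ : (TPt 4 N' → ℂ) → (Λ ⊕ C₀ → ℝ) → (Λ → ℂ))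
    -- the (2.3) characteristic functions: χ_{Y₀} ∈ [0,1] supported on the small fields, χᶜ_P = Π indicators
    (χY₀ χcP : (Λ → ℝ) → ℝ) (hχ0 : ∀ B, 0 ≤ χY₀ B) (hχ1 : ∀ B, χY₀ B ≤ 1)
    (P : Finset Λ) (hPcard : P.card = t.2.card) {rP : ℝ} (hrP : 0 ≤ rP)
    (hχc : ∀ B, χcP B = ∏ b ∈ P, (if rP ≤ |B b| then (1 : ℝ) else 0))
    (Dfam : Finset (TDom 4 (L * N'))) (V : TDom 4 (L * N') → (Λ → ℝ) → ℂ)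
    -- NEW (gen 6): the HISTORY part of the potentials in the bond variables, to be SUBTRACTED (print's `V″(Y, B̃)` of (1.42))
    (Vh : TDom 4 (L * N') → (Λ → ℝ) → ℂ)
    -- the record's objects behind the term: bonds, cubes, the real field inside the configurations, the potentials
    (ι : Λ → W.Bond) (hι : Function.Injective ι) (cube : W.Bond → TPt 4 (L * N'))
    (hQsupp : ∀ (Y : TDom 4 (L * N')) φ b b', W.Q Y φ b b' ≠ 0 → cube b ∈ Y.1 ∧ cube b' ∈ Y.1)
    {m' : ℕ} (hfibc : ∀ a : TPt 4 (L * N'), (Finset.univ.filter fun j => cube (ι j) = a).card ≤ m')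
    (emb : (Λ → ℝ) → W.Φ) (hBv : ∀ B b, W.Bv (emb B) (ι b) = (B b : ℂ))
    (hBv0 : ∀ B b', b' ∉ Set.range ι → W.Bv (emb B) b' = 0)
    (hV : ∀ Y ∈ Dfam, ∀ B, emb B ∈ W.sp1 Y → V Y B = W.V Y (emb B))
    (hVh : ∀ Y ∈ Dfam, ∀ B, emb B ∈ W.sp1 Y → Vh Y B = W.Vpp Y (emb B))
    (hχsupp : ∀ B, χY₀ B ≠ 0 → ∀ Y ∈ Dfam, emb B ∈ W.sp1 Y)
    -- REPLACES the separate analyticity `hΨσ ∕ hΨτ`: entrywise σ-holomorphy of `A(σ)` on the OPEN `e^{κ₁⁺}`-polydisc,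
    -- measurability of `χ_{k,Y₀}`, of the potentials and of the small-field region in the bond variables
    (hAhol : ∀ i j, DifferentiableOn ℂ (fun σ => A σ i j)
      {σ : TPt 4 N' → ℂ | ∀ j, σ j ∈ Metric.ball (0 : ℂ) (Real.exp cp.κ₁)})
    (hχm : Measurable χY₀) (hVm : ∀ Y, Measurable (V Y)) (hVhm : ∀ Y, Measurable (Vh Y))
    (hsmallm : MeasurableSet {B : Λ → ℝ | ∀ Y ∈ Dfam, emb B ∈ W.sp1 Y})
    {C : Matrix Λ Λ ℝ} (hC : C.PosDef) (Γ₀ : Matrix Λ (Λ ⊕ C₀) ℝ)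
    (hAs : ∀ σ : TPt 4 N' → ℂ, (∀ j, ‖σ j‖ ≤ Real.exp cp.κ₁) → (A σ).IsSymm)
    (hA : ∀ σ : TPt 4 N' → ℂ, (∀ j, ‖σ j‖ ≤ Real.exp cp.κ₁) → ((A σ).map Complex.re).PosDef)
    (G : (TPt 4 N' → ℂ) → Matrix Λ (Λ ⊕ C₀) ℂ)
    (hlin : ∀ σ : TPt 4 N' → ℂ, (∀ j, ‖σ j‖ ≤ Real.exp cp.κ₁) →
      ∀ X : Λ ⊕ C₀ → ℝ, Γ σ X = G σ *ᵥ fun j => (X j : ℂ))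
    (hGhol : ∀ i j, DifferentiableOn ℂ (fun σ => G σ i j)
      {σ : TPt 4 N' → ℂ | ∀ j, σ j ∈ Metric.ball (0 : ℂ) (Real.exp cp.κ₁)})
    {γ₂ : ℝ} (hγ₂ : 0 ≤ γ₂)
    -- bonds located on the torus `UT Nf` (for the kernel letters)
    (locΛ : Λ → UT Nf) (locN : Λ ⊕ C₀ → UT Nf) {m : ℕ}
    (hfibΛ : ∀ x : UT Nf, (Finset.univ.filter fun i => locΛ i = x).card ≤ m)
    (hfibN : ∀ x : UT Nf, (Finset.univ.filter fun j => locN j = x).card ≤ m)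
    -- rates and constants
    {kap kap' kap'' θ θE θΓ θC KG KΓ KCs K₀' : ℝ} (hkap'' : 0 < kap'') (h1 : kap'' < kap') (h2 : kap' < kap)
    (hθE : 0 ≤ θE) (hθΓ : 0 ≤ θΓ) (hθC : 0 ≤ θC) (hKG : 0 ≤ KG) (hKΓ : 0 ≤ KΓ) (hKCs : 0 ≤ KCs) (hK₀ : 0 ≤ K₀')
    (hθEle : θE ≤ θ) (hθΓle : θΓ ≤ θ)
    (hθR1le : (m * (1 + 2 / (kap - kap')) ^ ν) * (m * (1 + 2 / (kap' - kap'')) ^ ν)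
      * (θΓ * KCs * KG + KΓ * θC * KG + KΓ * K₀' * θΓ) ≤ θ)
    -- uniform localisation of the primitive kernels in the torus distance (L17a)
    (hG : ∀ σ : TPt 4 N' → ℂ, (∀ j, ‖σ j‖ ≤ Real.exp cp.κ₁) →
      ∀ b j, ‖G σ b j‖ ≤ KG * Real.exp (-(kap * tdist1 Nf (locΛ b) (locN j))))
    (hΓ₀ : ∀ b j, ‖Γ₀ b j‖ ≤ KΓ * Real.exp (-(kap * tdist1 Nf (locΛ b) (locN j))))
    (hCs : ∀ σ : TPt 4 N' → ℂ, (∀ j, ‖σ j‖ ≤ Real.exp cp.κ₁) →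
      ∀ b b', ‖(A σ)⁻¹ b b'‖ ≤ KCs * Real.exp (-(kap * tdist1 Nf (locΛ b) (locΛ b'))))
    (hC216 : ∀ b b', ‖C b b'‖ ≤ K₀' * Real.exp (-(kap * tdist1 Nf (locΛ b) (locΛ b'))))
    -- the (2.16)-type differences of the primitive kernels in the torus distance (L16a)
    (hdΓ : ∀ σ : TPt 4 N' → ℂ, (∀ j, ‖σ j‖ ≤ Real.exp cp.κ₁) →
      ∀ b j, ‖(G σ - Γ₀.map (algebraMap ℝ ℂ)) b j‖ ≤ θΓ * Real.exp (-(kap * tdist1 Nf (locΛ b) (locN j))))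
    (hdC : ∀ σ : TPt 4 N' → ℂ, (∀ j, ‖σ j‖ ≤ Real.exp cp.κ₁) →
      ∀ b b', ‖((A σ)⁻¹ - C.map (algebraMap ℝ ℂ)) b b'‖
        ≤ θC * Real.exp (-(kap * tdist1 Nf (locΛ b) (locΛ b'))))
    (hdE : ∀ σ : TPt 4 N' → ℂ, (∀ j, ‖σ j‖ ≤ Real.exp cp.κ₁) →
      ∀ b b', ‖(A σ - C⁻¹.map (algebraMap ℝ ℂ)) b b'‖ ≤ θE * Real.exp (-(kap * tdist1 Nf (locΛ b) (locΛ b'))))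
    (hsmallKθ : K₀' * (m * (1 + 2 / kap) ^ ν) * (θ * (m * (1 + 2 / kap'') ^ ν)) < 1)
    -- the (2.24)–(2.25) smallness, with `a₂₀ = 2·m′·α₄·M⁻⁴(1 + 32/(κ₁−1))⁴` (the factor 2 = the τ-region's radius ratio)
    {cE g : ℝ} (hc0 : 0 ≤ cE) (hc : ∀ k, hC.1.eigenvalues k ≤ cE)
    (hαc : (2 * (θ * (m * (1 + 2 / kap'') ^ ν)) +
      (γ₂ + 2 * (m' * c.α₄ * (c.M ^ 4)⁻¹ * (1 + 32 / (c.κ₁ - 1)) ^ 4))) * cE ≤ 1 / 2) (hg : 0 ≤ g)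
    (hΓq : ∀ X : Λ ⊕ C₀ → ℝ, (Γ₀ *ᵥ X) ⬝ᵥ (C *ᵥ (Γ₀ *ᵥ X)) ≤ g * (X ⬝ᵥ X))
    (hsmall : (2 * (θ * (m * (1 + 2 / kap'') ^ ν)) +
      (γ₂ + 2 * (m' * c.α₄ * (c.M ^ 4)⁻¹ * (1 + 32 / (c.κ₁ - 1)) ^ 4))) * (1 + 2 * cE * g) ≤ 1 / 2)
    -- constant matching, p. 17, with `w = 2·K₀(64,8)·α₄·#(⋃𝐃)`
    {a a₅ : ℝ} (hPa : a ≤ γ₂ * rP ^ 2)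
    (hvol : 2 * (K₀' * (m * (1 + 2 / kap) ^ ν) * (θ * (m * (1 + 2 / kap'') ^ ν))
              * (1 + (1 - K₀' * (m * (1 + 2 / kap) ^ ν) * (θ * (m * (1 + 2 / kap'') ^ ν)))⁻¹) / 2)
          * (Fintype.card Λ : ℝ)
        + 2 * (K₀ 64 8 * c.α₄ * (((Dfam.image Subtype.val).biUnion id).card : ℝ))
        + (2 * (θ * (m * (1 + 2 / kap'') ^ ν)) +
            (γ₂ + 2 * (m' * c.α₄ * (c.M ^ 4)⁻¹ * (1 + 32 / (c.κ₁ - 1)) ^ 4))) * cE * (Fintype.card Λ : ℝ)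
        + (2 * (θ * (m * (1 + 2 / kap'') ^ ν)) +
            (γ₂ + 2 * (m' * c.α₄ * (c.M ^ 4)⁻¹ * (1 + 32 / (c.κ₁ - 1)) ^ 4))) * (1 + 2 * cE * g)
            * (Fintype.card (Λ ⊕ C₀) : ℝ)
        ≤ a₅ * ((Z.1).card : ℝ)) :
    ‖term214 r lZ lD (core214 A Γ (F214 t.2.card χY₀ χcP Dfam (fun Y B => V Y B - Vh Y B))) 0 0‖ ≤
      weight L M c Z a t * Real.exp (a₅ * ((Z.1).card : ℝ)) := by
  have hM0 : 0 < c.M := by linarith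
  have hrepr' : B13.Repr142 (twoTorusHistMul W 0).toStepData := by
    rw [toStepData_twoTorusHistMul]; exact repr142_histMul W.toStepData 0 hrepr
  have h143' : B13.Bound143 (twoTorusHistMul W 0).toStepData c := by
    rw [toStepData_twoTorusHistMul]; exact h143
  -- (1.36) for the ZERO history, at the record's own (floor) scale: `‖0·V″‖ = 0 ≤ …`
  have h136' : B13.Bound136 (twoTorusHistMul W 0).toStepData c (twoTorusHistMul W 0).Vpp := by
    intro Y φ _
    show ‖(0 : ℂ) * W.Vpp Y φ‖ ≤ _
    rw [zero_mul, norm_zero]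
    positivity
  have hV' : ∀ Y ∈ Dfam, ∀ B, emb B ∈ (twoTorusHistMul W 0).sp1 Y →
      V Y B - Vh Y B = (twoTorusHistMul W 0).V Y (emb B) := by
    intro Y hY B hB
    show V Y B - Vh Y B = W.V Y (emb B) + (0 - 1) * W.Vpp Y (emb B)
    rw [hV Y hY B hB, hVh Y hY B hB]; ring
  have hVm' : ∀ Y, Measurable fun B => V Y B - Vh Y B := fun Y => (hVm Y).sub (hVhm Y)
  exact h226_torus_of_primitives_of_lemma2_holo c hκ₁1 hα₆ (twoTorusHistMul W 0) hrepr' h143' h136' hvolk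
    h12 hC₃ hE hε hC₁ hα hM hκ₁ hδκ Z t hpos hhalf cp hκp hr hr1 lZ hlZ lD hlD A Γ χY₀ χcP hχ0 hχ1 P hPcard hrP hχc
    Dfam (fun Y B => V Y B - Vh Y B) ι hι cube hQsupp hfibc emb hBv hBv0 hV' hχsupp hAhol hχm hVm' hsmallm hC Γ₀
    hAs hA G hlin hGhol hγ₂ locΛ locN hfibΛ hfibN hkap'' h1 h2 hθE hθΓ hθC hKG hKΓ hKCs hK₀ hθEle hθΓle hθR1le hG hΓ₀ hCs
    hC216 hdΓ hdC hdE hsmallKθ hc0 hc hαc hg hΓq hsmall hPa hvol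

end K6

/-! ## §7 (gen 6). THE `z`-ANALYTICITY CHAIN OF (L♭) — a BY-NAME CENSUS of the tree, and its two ends in kernel

CRIT-1's second named leaf was the "KP-analyticity leaf": (L♭) asserts that the [II]-output functional of the MULTIPLIED input is HOLOMORPHIC
in the multiplier `z` on the disc `‖z‖ < Ē'/E`, so that Schwarz turns the uniform bound at the cap into the contraction (L).  THE TREE
ALREADY HOLDS EVERY LINK OF THAT CHAIN FOR A GENERIC COMPLEX PARAMETER ENTERING ONLY THE POTENTIALS — which is exactly how the history
multiplier enters ([II] Lemma 2 ∕ (1.41): the older terms enter the step through, and only through, `𝐕_k(Y, ·)`, linearly):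
* term level — `B13Term214ParamHolo` (module 36): `differentiableOn_F214_param`, `differentiableOn_core214_lastLine` (the `X`-integral of
  (2.14), generic letters), ★ `differentiableOn_term214_param_polyτ` ∕ `differentiableOn_term214_torus_param_of_primitives_holo_polyτ` (the
  whole printed term, from the primitive kernels); and for the W1 term datum `B13TermDatum214ParamHolo.h226T_of_inputs226Holo` (module 37):
  BOTH HALVES — holomorphy AND the (2.26) weight — «along any holomorphically parametrised history `cv`»; (L♭)'s pencil is `cv z := z • old`;
* activity level — `H(Z) = Σ_j T_j` is a FINITE sum of terms (`B13Bound238Assembly` ∕ `B13Lemma3Assembly.bound238With_of_226`, record-parametric):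
  holomorphy passes by `DifferentiableOn.fun_sum`, the (2.38) bound at the cap by feeding §6's per-term bound;
* output level — `B13LocEAnalytic`: `B13Resummation.differentiableOn_locE_param_of_kp` ((2.13)'s `E^{(k+1)}(X)` is holomorphic in a Banach
  parameter under a parameter-UNIFORM [KP86] condition (1) — at the cap: (2.38) at scale `Ē'` via `B13Resummation.kp_condition`);
* Schwarz — Mathlib's `Complex.dist_le_div_mul_dist_of_mapsTo_ball`.
This section instantiates the two ends in kernel: (a) the `X`-integral of (2.14) with potentials `V_q + z·V_h` is holomorphic in `z` — ONE
application of module 36; (d) SCHWARZ AT (2.13): `‖E(X; z=1) − E(X; z=0)‖ ≤ 2N/R` from any `z`-uniform bound `N` on the disc of radius `R > 1`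
— ONE application of `B13LocEAnalytic` + Mathlib.  Nothing in between is restated. -/

section ZChain

open Literature.MathematicalPhysics.QuantumFieldTheory.Balaban1983to89.B13Term214 (term214 SepHolOn core214 F214)
open Literature.Probability.LatticeModels
open Matrix

variable {Λ : Type} [Fintype Λ] [DecidableEq Λ] {C₀ : Type} [Fintype C₀] [DecidableEq C₀]

/-- **(a) The `X`-integral of (2.14) is holomorphic in the history multiplier** — `B13Term214ParamHolo.differentiableOn_core214_lastLine`
(parameter space `ℂ ∋ z`, potentials `𝐕_z := V_q + z·V_h`, affine hence holomorphic in `z`; operators `A(σ)`, `Γ(σ)` and `τ` fixed; the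
(2.15)–(2.23) letters at that `σ`; the (2.20)-shape UNIFORM on the `z`-set — supplied on a disc by §1 `shape220_histMul`, or, at the cap
record, by Lemma 2's rows as inside §6).  [by name, on: Balaban1988RG2Cluster, (2.14)–(2.15) p.15, (2.16)–(2.22) p.16, (2.23) p.17] -/
theorem differentiableOn_core214_histMul {ι : Type*} {D : Type*} [Fintype D] [DecidableEq D] {Uz : Set ℂ} (hU : IsOpen Uz)
    {Aσ : (ι → ℂ) → Matrix Λ Λ ℂ} {Γσ : (ι → ℂ) → (Λ ⊕ C₀ → ℝ) → (Λ → ℂ)} (σ : ι → ℂ) (τ : D → ℂ)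
    (hAs : (Aσ σ).IsSymm) (hApos : ((Aσ σ).map Complex.re).PosDef) (hΓc : Continuous (Γσ σ))
    (cardP : ℕ) {χY₀ χcP : (Λ → ℝ) → ℝ} (hχm : Measurable χY₀) (hχcm : Measurable χcP)
    (hχ0 : ∀ B, 0 ≤ χY₀ B) (hχc0 : ∀ B, 0 ≤ χcP B) (Dfam : Finset D) {Vq Vh : D → (Λ → ℝ) → ℂ}
    (hVqm : ∀ Y, Measurable (Vq Y)) (hVhm : ∀ Y, Measurable (Vh Y)) {γ₂ rP a₂₀ w : ℝ} (qP : (Λ → ℝ) → ℝ)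
    (h222 : ∀ B, χY₀ B * χcP B ≤ Real.exp (-(γ₂ / 2 * rP ^ 2 * cardP) + γ₂ / 2 * qP B)) (hγ₂ : 0 ≤ γ₂)
    (hqP : ∀ B, qP B ≤ B ⬝ᵥ B) (ha₂₀ : 0 ≤ a₂₀)
    (h220z : ∀ z ∈ Uz, ∀ B, ∑ Y ∈ Dfam, ‖τ Y‖ * ‖Vq Y B + z * Vh Y B‖ ≤ a₂₀ / 2 * (B ⬝ᵥ B) + w)
    {C : Matrix Λ Λ ℝ} (hC : C.PosDef) {Γ₀ : Matrix Λ (Λ ⊕ C₀) ℝ} {ρ η cE g : ℝ} (hρ0 : 0 ≤ ρ)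
    (hR1 : ∀ X : Λ ⊕ C₀ → ℝ, -(1 / 2) * ((Γσ σ X) ⬝ᵥ ((Aσ σ)⁻¹ *ᵥ Γσ σ X)).re
      ≤ -(1 / 2 * ((Γ₀ *ᵥ X) ⬝ᵥ (C *ᵥ (Γ₀ *ᵥ X)))) + ρ / 2 * (X ⬝ᵥ X))
    (h17a : Real.sqrt (‖(Aσ σ).det‖ / ((Aσ σ).map Complex.re).det) ≤ Real.exp (η * Fintype.card Λ))
    (h17b : Real.sqrt (((Aσ σ).map Complex.re).det / C⁻¹.det) ≤ Real.exp (η * Fintype.card Λ))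
    (hR2 : ∀ B : Λ → ℝ, B ⬝ᵥ ((C⁻¹ - (Aσ σ).map Complex.re) *ᵥ B) ≤ ρ * (B ⬝ᵥ B))
    (hR3 : ∀ (X : Λ ⊕ C₀ → ℝ) (B : Λ → ℝ), -(B ⬝ᵥ fun i => (Γσ σ X i).re)
      ≤ -(B ⬝ᵥ (Γ₀ *ᵥ X)) + ρ / 2 * (X ⬝ᵥ X + B ⬝ᵥ B))
    (hc0 : 0 ≤ cE) (hc : ∀ k, hC.1.eigenvalues k ≤ cE) (hαc : (2 * ρ + (γ₂ + a₂₀)) * cE ≤ 1 / 2)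
    (hΓ0 : ∀ X : Λ ⊕ C₀ → ℝ, (Γ₀ *ᵥ X) ⬝ᵥ (C *ᵥ (Γ₀ *ᵥ X)) ≤ g * (X ⬝ᵥ X))
    (hsmall : (2 * ρ + (γ₂ + a₂₀)) * (1 + 2 * cE * g) < 1) :
    DifferentiableOn ℂ (fun z => core214 Aσ Γσ (F214 cardP χY₀ χcP Dfam (fun Y B => Vq Y B + z * Vh Y B)) σ τ) Uz :=
  B13Term214ParamHolo.differentiableOn_core214_lastLine hU σ hAs hApos hΓc cardP hχm hχcm hχ0 hχc0 Dfam
    (Vk := fun z Y B => Vq Y B + z * Vh Y B) (fun z _ Y => (hVqm Y).add ((hVhm Y).const_mul z))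
    (fun _ _ => (differentiableOn_const _).add (differentiableOn_id.mul (differentiableOn_const _))) τ qP h222 hγ₂ hqP
    ha₂₀ h220z hC hρ0 hR1 h17a h17b hR2 hR3 hc0 hc hαc hΓ0 hsmall

/-- **(d) SCHWARZ AT (2.13): the history channel of the [II] output is the cap's uniform bound divided by the window ratio.**
With the polymer activities a holomorphic family `w_z` on the disc `‖z‖ < R` (`R = Ē'/E > 1`) obeying [KP86] (1) uniformly there —
so that `z ↦ E(X; w_z)` is holomorphic (`B13Resummation.differentiableOn_locE_param_of_kp`, by name) — and ANY `z`-uniform bound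
`‖E(X; w_z)‖ ≤ N` on the disc (at the cap: the (2.41)-shape, `B13Resummation.norm_locE_le`), the D-channel `𝓓(X) = E(X; w₁) − E(X; w₀)`
obeys `‖𝓓(X)‖ ≤ 2N/R`.  This is (L♭) ⟹ (L) at the level of print's OUTPUT FUNCTIONAL with `ρ·(format) = 2N/R`; no transport, no
telescoping, no Grönwall. [this work, on: Balaban1988RG2Cluster, (2.13) p.14 and p.15, (2.41) p.20; KoteckyPreiss1986 p.493; Schwarz lemma] -/
theorem norm_locE_hist_sub_le {Dom Cube : Type*} [DecidableEq Dom] [DecidableEq Cube] [Fintype Dom]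
    (ι : Dom → Dom → Prop) [DecidableRel ι] [Std.Refl ι] [Std.Symm ι] (cubes : Dom → Finset Cube) {R N : ℝ} (hR : 1 < R)
    {w : ℂ → Dom → ℂ} (hw : ∀ Z, DifferentiableOn ℂ (fun z => w z Z) (Metric.ball 0 R)) {a : Dom → ℝ}
    (hKP : ∀ z ∈ Metric.ball (0 : ℂ) R, IsKPVolume ι (w z) a Finset.univ) (X : Finset Cube)
    (hN : ∀ z ∈ Metric.ball (0 : ℂ) R, ‖B13Resummation.locE ι cubes (w z) X‖ ≤ N) :
    ‖B13Resummation.locE ι cubes (w 1) X - B13Resummation.locE ι cubes (w 0) X‖ ≤ 2 * N / R := by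
  have h0 : (0 : ℂ) ∈ Metric.ball (0 : ℂ) R := Metric.mem_ball_self (by linarith)
  have h1 : (1 : ℂ) ∈ Metric.ball (0 : ℂ) R := by
    rw [Metric.mem_ball, dist_zero_right, norm_one]; exact hR
  have hd := B13Resummation.differentiableOn_locE_param_of_kp ι cubes X Metric.isOpen_ball hw hKP
  have hmaps : Set.MapsTo (fun z => B13Resummation.locE ι cubes (w z) X) (Metric.ball 0 R)
      (Metric.closedBall (B13Resummation.locE ι cubes (w 0) X) (2 * N)) := by
    intro z hz
    rw [Metric.mem_closedBall, dist_eq_norm]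
    calc ‖B13Resummation.locE ι cubes (w z) X - B13Resummation.locE ι cubes (w 0) X‖
        ≤ ‖B13Resummation.locE ι cubes (w z) X‖ + ‖B13Resummation.locE ι cubes (w 0) X‖ := norm_sub_le _ _
      _ ≤ N + N := add_le_add (hN z hz) (hN 0 h0)
      _ = 2 * N := by ring
  have hS := Complex.dist_le_div_mul_dist_of_mapsTo_ball hd hmaps h1
  rw [dist_eq_norm, dist_zero_right, norm_one, mul_one] at hS
  exact hS

/-- **(d′) the contraction letter.**  If the uniform bound at the cap has the FORMAT SHAPE `N = E₁·e^{−κ d(X)}` and the window ratio is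
`R = Ē'/E`, then `‖𝓓(X)‖ ≤ (2E₁/Ē')·E·e^{−κ d(X)}` — (L) with `ρ := 2E₁/Ē'`, a contraction iff the cap exceeds twice the cap's output
constant (by §1 `schwarzSlope_eq` the ratio `E₁(Ē')/Ē'` is `Ē'`-FREE: print's R23 letter). [this work; arithmetic] -/
theorem hist_contraction_letter {D E Ē' E₁ κd : ℝ} (hE : 0 < E) (hĒ : E < Ē')
    (hD : D ≤ 2 * (E₁ * Real.exp (-κd)) / (Ē' / E)) :
    D ≤ (2 * E₁ / Ē') * E * Real.exp (-κd) := by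
  have hĒ0 : 0 < Ē' := hE.trans hĒ
  calc D ≤ 2 * (E₁ * Real.exp (-κd)) / (Ē' / E) := hD
    _ = (2 * E₁ / Ē') * E * Real.exp (-κd) := by field_simp

end ZChain

/-! ## §8 (gen 6). THE CAP LETTERS, and (2.38) AT THE CAP as a receipt

Every smallness letter the tree's [II] chain CONSUMES, read at the cap record `withE₀ c Ē'`, has the ONE shape `Ē'·(E₀-free) ≤ const`:
the τ-cap (§5 `invTau_withE₀_le_half_of_cap`), R15 (`R15_withE₀_iff`), R18half ∕ R18sharp (`R18half_withE₀_iff`, `R18sharp_withE₀_iff`)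
and the [KP86] smallness of (2.12) (`kpSmall_withE₀_iff`, the `hsmall` slot of `B13Resummation.kp_condition` with `A := C3act(Ē')ε₁`);
the absorption of the honest constants into print's `C₃` is SCALE-FREE (`absorbC3_iff`, `absorbC3_withE₀`) and R17 is MONOTONE
(`eps2_withE₀_mono`) — R23 was shown scale-free in §1 (`schwarzSlope_le_one_iff`) and R12 monotone in §5.  Hence the window's cap is
`Ē' ≤ min_i (const_i / slope_i)` over print's OWN letters — no new letter — and (2.38) AT THE CAP for ANY two-torus record (in particular
the history-multiplied record with its own output `H` and terms `T`) follows from termwise (2.26) at the cap (§6, per term) by the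
tree's `B13Lemma3TorusTerms.bound238_torus_of_226` READ AT `withE₀ c Ē'`: `bound238_cap_of_termwise`, whose binder list is that
theorem's with the floor record's E₀-free letters verbatim, R17 at the floor, the scale-free C₃-absorption, and exactly THREE cap
inequalities; and (I.1.18) with `½Ē'` AT THE CAP (`bound118_cap_of_termwise`, edition 3) by composing with the tree's [KP86] discharge
`B13Resummation.bound118_of_KP` read at the cap: R22 ∕ largeness ∕ `A₂` verbatim, R23 scale-free (`R23_withE₀_iff`), one more cap
inequality (KP smallness).  Receipts (bookkeeping over typed theorems); they assert nothing of Bałaban's. -/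

section CapLetters

open Literature.MathematicalPhysics.QuantumFieldTheory.Balaban1983to89.TreeLengthTorus (TPt TDom tsys)
open Literature.MathematicalPhysics.QuantumFieldTheory.Balaban1983to89.B13Lemma3TorusData (TBond)
open Literature.MathematicalPhysics.QuantumFieldTheory.Balaban1983to89.B13Lemma3TorusTerms (weight Z0 terms)
open Literature.MathematicalPhysics.QuantumFieldTheory.Balaban1983to89.B13Lemma3Torus (TwoTorusStep)
open Literature.MathematicalPhysics.QuantumFieldTheory.Balaban1983to89.B12TreeDecay (kappa₀ K₀)

/-- **R15 at the cap**: `ε₂(Ē')e^{5κ} ≤ 1 ⟺ Ē'·ε₁K₀e^{5κ} ≤ 1`. [cite: Balaban1988RG2Cluster, p.18 (before (2.28)), R15] -/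
theorem R15_withE₀_iff (c : B13.Consts) (E' : ℝ) :
    (withE₀ c E').R15 ↔ E' * c.ε₁ * c.K₀ * Real.exp (5 * c.κ) ≤ 1 := by
  unfold B13.Consts.R15
  rw [eps2_withE₀]
  exact Iff.rfl

/-- **R17 is monotone in the format**: `ε₂(E₀) ≤ ε₂(E')` for `E₀ ≤ E'` (`ε₁K₀ ≥ 0`). [cite: Balaban1988RG2Cluster, p.19 (ε₂), R17] -/
theorem eps2_withE₀_mono (c : B13.Consts) {E' : ℝ} (hk : 0 ≤ c.ε₁ * c.K₀) (hE : c.E₀ ≤ E') :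
    c.eps2 ≤ (withE₀ c E').eps2 := by
  rw [eps2_withE₀]
  unfold B13.Consts.eps2
  calc c.E₀ * c.ε₁ * c.K₀ = c.E₀ * (c.ε₁ * c.K₀) := by ring
    _ ≤ E' * (c.ε₁ * c.K₀) := mul_le_mul_of_nonneg_right hE hk
    _ = E' * c.ε₁ * c.K₀ := by ring

/-- **R18half at the cap**: `(L+2)⁴·A·ε₂(Ē') ≤ ½ ⟺ (L+2)⁴A·(Ē'ε₁K₀) ≤ ½`. [cite: Balaban1988RG2Cluster, p.20 (before (2.37)), R18] -/
theorem R18half_withE₀_iff (c : B13.Consts) (E' A : ℝ) :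
    B13Step237.R18half (withE₀ c E') A ↔ ((c.L : ℝ) + 2) ^ 4 * A * (E' * c.ε₁ * c.K₀) ≤ 1 / 2 := by
  unfold B13Step237.R18half B13Step237.memberF
  rw [eps2_withE₀]
  exact Iff.rfl

/-- **R18sharp at the cap**: `2(L+2)⁴A·ε₂(Ē')·e^{5(1−7δ)ℓκ} ≤ α₆ ⟺ 2(L+2)⁴A·(Ē'ε₁K₀)·e^{5(1−7δ)ℓκ} ≤ α₆`.
[cite: Balaban1988RG2Cluster, p.20 (before (2.37)), R18 (consumed form)] -/
theorem R18sharp_withE₀_iff (c : B13.Consts) (E' A ℓ : ℝ) :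
    B13Step237.R18sharp (withE₀ c E') A ℓ ↔
      2 * ((c.L : ℝ) + 2) ^ 4 * A * (E' * c.ε₁ * c.K₀) * Real.exp (5 * ((1 - 7 * c.δ) * ℓ * c.κ)) ≤ c.α₆ := by
  unfold B13Step237.R18sharp
  rw [B13Step237.bracketF_eq, eps2_withE₀]
  exact Iff.rfl

/-- **The absorption of the honest constants into print's `C₃` is SCALE-FREE**: `bracketF(c, A)/α₆ · X ≤ C₃(c)ε₁` — the `hC3` slot of
`bound238_torus_of_226` — is, after division by `E₀ > 0`, the `E₀`-free inequality `2(L+2)⁴A(ε₁K₀)/α₆ · X ≤ 2(L+2)⁴A₁K₀ε₁`.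
[cite: Balaban1988RG2Cluster, p.20 (C₃ of (2.38)); this work (bookkeeping)] -/
theorem absorbC3_iff (c : B13.Consts) (A X : ℝ) (hE : 0 < c.E₀) :
    B13Step237.bracketF c A / c.α₆ * X ≤ c.C3act * c.ε₁ ↔
      2 * ((c.L : ℝ) + 2) ^ 4 * A * (c.ε₁ * c.K₀) / c.α₆ * X ≤ 2 * ((c.L : ℝ) + 2) ^ 4 * c.A₁ * c.K₀ * c.ε₁ := by
  have hl : B13Step237.bracketF c A / c.α₆ * X = c.E₀ * (2 * ((c.L : ℝ) + 2) ^ 4 * A * (c.ε₁ * c.K₀) / c.α₆ * X) := by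
    rw [B13Step237.bracketF_eq]; unfold B13.Consts.eps2; ring
  have hr : c.C3act * c.ε₁ = c.E₀ * (2 * ((c.L : ℝ) + 2) ^ 4 * c.A₁ * c.K₀ * c.ε₁) := by
    unfold B13.Consts.C3act; ring
  rw [hl, hr]
  exact ⟨fun h => le_of_mul_le_mul_left h hE, fun h => mul_le_mul_of_nonneg_left h hE.le⟩

/-- … and therefore holds AT THE CAP whenever it holds scale-free (any `Ē' ≥ 0`). [this work (bookkeeping)] -/
theorem absorbC3_withE₀ (c : B13.Consts) {E' : ℝ} (hE' : 0 ≤ E') (A X : ℝ)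
    (h : 2 * ((c.L : ℝ) + 2) ^ 4 * A * (c.ε₁ * c.K₀) / c.α₆ * X ≤ 2 * ((c.L : ℝ) + 2) ^ 4 * c.A₁ * c.K₀ * c.ε₁) :
    B13Step237.bracketF (withE₀ c E') A / (withE₀ c E').α₆ * X ≤ (withE₀ c E').C3act * (withE₀ c E').ε₁ := by
  have hl : B13Step237.bracketF (withE₀ c E') A / (withE₀ c E').α₆ * X =
      E' * (2 * ((c.L : ℝ) + 2) ^ 4 * A * (c.ε₁ * c.K₀) / c.α₆ * X) := by
    rw [B13Step237.bracketF_eq, eps2_withE₀]; simp only [withE₀_L, withE₀_α₆]; ring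
  have hr : (withE₀ c E').C3act * (withE₀ c E').ε₁ = E' * (2 * ((c.L : ℝ) + 2) ^ 4 * c.A₁ * c.K₀ * c.ε₁) := by
    rw [C3act_withE₀, withE₀_ε₁]; ring
  rw [hl, hr]
  exact mul_le_mul_of_nonneg_left h hE'

/-- **The [KP86] smallness of (2.12) at the cap** (the `hsmall` slot of `B13Resummation.kp_condition` with `A := C₃(Ē')ε₁`):
`C₃(Ē')ε₁·X ≤ τ ⟺ Ē'·(2(L+2)⁴A₁K₀ε₁·X) ≤ τ`. [cite: Balaban1988RG2Cluster, p.20 (after (2.38)); KoteckyPreiss1986 (1)] -/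
theorem kpSmall_withE₀_iff (c : B13.Consts) (E' X τ : ℝ) :
    (withE₀ c E').C3act * (withE₀ c E').ε₁ * X ≤ τ ↔ E' * (2 * ((c.L : ℝ) + 2) ^ 4 * c.A₁ * c.K₀ * c.ε₁ * X) ≤ τ := by
  have : (withE₀ c E').C3act * (withE₀ c E').ε₁ * X = E' * (2 * ((c.L : ℝ) + 2) ^ 4 * c.A₁ * c.K₀ * c.ε₁ * X) := by
    rw [C3act_withE₀, withE₀_ε₁]; ring
  rw [this]

variable {L N' : ℕ} [NeZero L] [NeZero N'] {M : ℕ} [NeZero M]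

open Classical in
/-- **(2.38) AT THE CAP for ANY two-torus record — in particular the history-multiplied record with its own output `H` and terms `T` —
from TERMWISE (2.26) at the cap** (§6 `h226_holo_histMul` per term) **and print's letters read at two scales**: the tree's
`B13Lemma3TorusTerms.bound238_torus_of_226` at the record `withE₀ c Ē'`.  Binders: that theorem's, with every `E₀`-FREE letter of the
floor record VERBATIM (`hα₆ … hAc`), R17 AT THE FLOOR (monotone), the SCALE-FREE C₃-absorption `hC3`, the sign letter `ε₁K₀ ≥ 0`, and
exactly THREE CAP INEQUALITIES `hR15'`, `h18half'`, `h18'` of the shape `Ē'·(E₀-free) ≤ const`.  A receipt: it asserts nothing of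
Bałaban's; termwise domination `hH` and the terms `T` are reader-supplied exactly as in the tree theorem.
[by name, on: Balaban1988RG2Cluster, Lemma 3 (2.38) p.20, (2.26) p.17, restrictions pp.18–21] -/
theorem bound238_cap_of_termwise (c : B13.Consts) (hL : 8 ≤ c.L) (hLc : c.L = L) {Ē' : ℝ} (hĒ0 : 0 ≤ Ē')
    (hEE : c.E₀ ≤ Ē') (hk : 0 ≤ c.ε₁ * c.K₀) (W' : TwoTorusStep 4 L N')
    (T : (Z : TDom 4 N') → Finset (TDom 4 (L * N')) × Finset (TBond 4 M (L * N')) → W'.Φ → ℂ)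
    {a a₂ a₂' a₅ Aabs : ℝ}
    (hH : ∀ (Z : TDom 4 N') (φ : W'.Φ), φ ∈ W'.sp2 Z → ‖W'.H Z φ‖ ≤ ∑ t ∈ terms L M Z, ‖T Z t φ‖)
    (h226 : ∀ (Z : TDom 4 N') (φ : W'.Φ), φ ∈ W'.sp2 Z → ∀ t ∈ terms L M Z,
      ‖T Z t φ‖ ≤ weight L M (withE₀ c Ē') Z a t * Real.exp (a₅ * ((Z.1).card : ℝ)))
    (hα₆ : 0 < c.α₆) (hδ : 0 ≤ c.δ) (hδ7 : 0 ≤ 1 - 7 * c.δ) (hκ : 0 ≤ c.κ) (ha : 0 ≤ a)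
    (hR16 : 18 * ((1 - 4 * c.δ) * c.κ) ≤ a / 20) (hR16' : 4 * c.κ ≤ a / 20)
    (h231 : 2 * (4 : ℝ) * (M : ℝ) ^ 4 * Real.exp (-(a / 10)) ≤ a / 20)
    (ha₂ : 0 ≤ a₂) (hκ229 : kappa₀ 64 8 + a₂ ≤ c.δ * c.κ)
    (hsm229 : c.α₆ * Real.exp a₂ * K₀ 64 8 * 64 ≤ a₂)
    (habsk : Real.exp (-(a / 20)) * 64 ≤ c.δ * c.κ)
    (ha₂' : 0 ≤ a₂') (hκ229' : kappa₀ 64 8 + a₂' ≤ c.δ * ((c.L : ℝ) / 2) * c.κ)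
    (hsm229' : c.α₆ * Real.exp a₂' * K₀ 64 8 * 64 ≤ a₂')
    (hR20 : 18 * ((1 - 7 * c.δ) * ((c.L : ℝ) / 2) * c.κ) ≤ (c.κ₁ - 1) / 2)
    (ha₅ : 0 ≤ a₅) (habs : a₅ + Real.exp (-((c.κ₁ - 1) / 2)) ≤ Aabs)
    (hAc : Aabs * 64 ≤ c.δ * ((c.L : ℝ) / 2) * c.κ)
    (hR17 : Real.exp (-(a / 20)) ≤ c.eps2)
    (hC3 : 2 * ((c.L : ℝ) + 2) ^ 4 * (K₀ 64 8 * Real.exp (Real.exp (-(a / 20)) * 64)) * (c.ε₁ * c.K₀) / c.α₆ *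
      Real.exp (Aabs * 64) ≤ 2 * ((c.L : ℝ) + 2) ^ 4 * c.A₁ * c.K₀ * c.ε₁)
    (hR15' : Ē' * c.ε₁ * c.K₀ * Real.exp (5 * c.κ) ≤ 1)
    (h18half' : ((c.L : ℝ) + 2) ^ 4 * (K₀ 64 8 * Real.exp (Real.exp (-(a / 20)) * 64)) * (Ē' * c.ε₁ * c.K₀) ≤ 1 / 2)
    (h18' : 2 * ((c.L : ℝ) + 2) ^ 4 * (K₀ 64 8 * Real.exp (Real.exp (-(a / 20)) * 64)) * (Ē' * c.ε₁ * c.K₀) *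
      Real.exp (5 * ((1 - 7 * c.δ) * ((c.L : ℝ) / 2) * c.κ)) ≤ c.α₆) :
    B13.Bound238 W'.toStepData (withE₀ c Ē') := by
  have hε₀' : 0 ≤ (withE₀ c Ē').eps2 := by
    rw [eps2_withE₀, mul_assoc]; exact mul_nonneg hĒ0 hk
  have hR15c : (withE₀ c Ē').R15 := (R15_withE₀_iff c Ē').2 hR15'
  have hR17c : Real.exp (-(a / 20)) ≤ (withE₀ c Ē').eps2 := hR17.trans (eps2_withE₀_mono c hk hEE)
  have h18halfc := (R18half_withE₀_iff c Ē' _).2 h18half'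
  have h18c := (R18sharp_withE₀_iff c Ē' _ _).2 h18'
  have hC3c := absorbC3_withE₀ c hĒ0 _ (Real.exp (Aabs * 64)) hC3
  exact B13Lemma3TorusTerms.bound238_torus_of_226 (withE₀ c Ē') hL hLc W' T hH h226 hα₆ hε₀' hδ hδ7 hκ ha hR15c hR16
    hR16' hR17c h231 ha₂ hκ229 hsm229 habsk h18halfc h18c ha₂' hκ229' hsm229' hR20 ha₅ habs hAc hC3c


/-- `C₃(E')ε₁ = E'·(2(L+2)⁴A₁K₀ε₁)` — the activity-times-coupling letter is `E'`-LINEAR. [cite: Balaban1988RG2Cluster, p.20 (C₃ of (2.38))] -/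
theorem C3eps1_withE₀_eq (c : B13.Consts) (E' : ℝ) :
    (withE₀ c E').C3act * (withE₀ c E').ε₁ = E' * (2 * ((c.L : ℝ) + 2) ^ 4 * c.A₁ * c.K₀ * c.ε₁) := by
  rw [C3act_withE₀, withE₀_ε₁]; ring

/-- **R23 at the cap is SCALE-FREE**: `A₂C₃(Ē')ε₁ ≤ ½Ē' ⟺ A₂·(2(L+2)⁴A₁K₀ε₁) ≤ ½` (`Ē' > 0`).
[cite: Balaban1988RG2Cluster, p.21 "O(1)C₃ε₁ ≤ ½E₀" (R23)] -/
theorem R23_withE₀_iff (c : B13.Consts) {E' : ℝ} (hE' : 0 < E') :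
    (withE₀ c E').R23 ↔ c.A₂ * (2 * ((c.L : ℝ) + 2) ^ 4 * c.A₁ * c.K₀ * c.ε₁) ≤ 1 / 2 := by
  have hl : (withE₀ c E').A₂ * (withE₀ c E').C3act * (withE₀ c E').ε₁ =
      E' * (c.A₂ * (2 * ((c.L : ℝ) + 2) ^ 4 * c.A₁ * c.K₀ * c.ε₁)) := by
    rw [mul_assoc, C3eps1_withE₀_eq, withE₀_A₂]; ring
  have hr : (withE₀ c E').E₀ / 2 = E' * (1 / 2) := by rw [withE₀_E₀]; ring
  unfold B13.Consts.R23
  rw [hl, hr]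
  exact ⟨fun h => le_of_mul_le_mul_left h hE', fun h => mul_le_mul_of_nonneg_left h hE'.le⟩

/-- … and the direction the chain consumes needs only `Ē' ≥ 0`. [this work (bookkeeping)] -/
theorem R23_withE₀_of_scaleFree (c : B13.Consts) {E' : ℝ} (hE' : 0 ≤ E')
    (h : c.A₂ * (2 * ((c.L : ℝ) + 2) ^ 4 * c.A₁ * c.K₀ * c.ε₁) ≤ 1 / 2) : (withE₀ c E').R23 := by
  have hl : (withE₀ c E').A₂ * (withE₀ c E').C3act * (withE₀ c E').ε₁ =
      E' * (c.A₂ * (2 * ((c.L : ℝ) + 2) ^ 4 * c.A₁ * c.K₀ * c.ε₁)) := by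
    rw [mul_assoc, C3eps1_withE₀_eq, withE₀_A₂]; ring
  have hr : (withE₀ c E').E₀ / 2 = E' * (1 / 2) := by rw [withE₀_E₀]; ring
  unfold B13.Consts.R23
  rw [hl, hr]
  exact mul_le_mul_of_nonneg_left h hE'

open Classical in
/-- **(I.1.18) WITH `½Ē'` AT THE CAP — the `z`-UNIFORM BOUND THE SCHWARZ STEP CONSUMES — for ANY two-torus record, from termwise
(2.26) at the cap, print's letters read at two scales, and the tree's [KP86] discharge of the [26]-step**: `bound238_cap_of_termwise`
∘ `B13.bound238With_half` ∘ `B13Resummation.bound118_of_KP`, all READ AT `withE₀ c Ē'`.  Extra binders over `bound238_cap_of_termwise`: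
the record's polymer GEOMETRY `G`, the restriction property of the spaces `hsp` (p. 15) and the representation (2.13) `hrep` — the three
record-only (format-free) inputs the tree's own §2 chain takes (`B13Resummation.deliverables_of_chainWith_KP`) —, print's R22 and the
E₀-free largeness `hlarge` VERBATIM, `A₂ ≥ e·ν·c₁·K₀²` VERBATIM, the sign letter `0 ≤ 2(L+2)⁴A₁K₀ε₁`, R23 in its SCALE-FREE form
(`R23_withE₀_iff`), and ONE more cap inequality — the [KP86] smallness `Ē'·(2(L+2)⁴A₁K₀ε₁·e^{5κ+1}K₀νc₁) ≤ 1`.  Conclusion: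
`|E^{(k+1)}(X)| ≤ ½Ē'·e^{−κ d_{k+1}(X)}` on the space of p. 15 for the record `W'` — with `W' :=` the history-multiplied record at any
`z` of the closed multiplier disc (§6 supplies its `h226`), this is the `N(X) = ½Ē'e^{−κd(X)}` of §7's `norm_locE_hist_sub_le`.  A receipt
over typed theorems; it asserts nothing of Bałaban's (`hH`, `hrep`, `hsp`, `G` and the per-term (2.26) are reader-supplied exactly as the
tree leaves them for the unmultiplied record). [by name, on: Balaban1988RG2Cluster, (2.38)–(2.41) pp.20–21, (I.1.18); KoteckyPreiss1986, Thm 1] -/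
theorem bound118_cap_of_termwise (c : B13.Consts) (hL : 8 ≤ c.L) (hLc : c.L = L) {Ē' : ℝ} (hĒ0 : 0 ≤ Ē')
    (hEE : c.E₀ ≤ Ē') (hk : 0 ≤ c.ε₁ * c.K₀) (W' : TwoTorusStep 4 L N')
    (T : (Z : TDom 4 N') → Finset (TDom 4 (L * N')) × Finset (TBond 4 M (L * N')) → W'.Φ → ℂ)
    {a a₂ a₂' a₅ Aabs : ℝ}
    (hH : ∀ (Z : TDom 4 N') (φ : W'.Φ), φ ∈ W'.sp2 Z → ‖W'.H Z φ‖ ≤ ∑ t ∈ terms L M Z, ‖T Z t φ‖)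
    (h226 : ∀ (Z : TDom 4 N') (φ : W'.Φ), φ ∈ W'.sp2 Z → ∀ t ∈ terms L M Z,
      ‖T Z t φ‖ ≤ weight L M (withE₀ c Ē') Z a t * Real.exp (a₅ * ((Z.1).card : ℝ)))
    (hα₆ : 0 < c.α₆) (hδ : 0 ≤ c.δ) (hδ7 : 0 ≤ 1 - 7 * c.δ) (hκ : 0 ≤ c.κ) (ha : 0 ≤ a)
    (hR16 : 18 * ((1 - 4 * c.δ) * c.κ) ≤ a / 20) (hR16' : 4 * c.κ ≤ a / 20)
    (h231 : 2 * (4 : ℝ) * (M : ℝ) ^ 4 * Real.exp (-(a / 10)) ≤ a / 20)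
    (ha₂ : 0 ≤ a₂) (hκ229 : kappa₀ 64 8 + a₂ ≤ c.δ * c.κ)
    (hsm229 : c.α₆ * Real.exp a₂ * K₀ 64 8 * 64 ≤ a₂)
    (habsk : Real.exp (-(a / 20)) * 64 ≤ c.δ * c.κ)
    (ha₂' : 0 ≤ a₂') (hκ229' : kappa₀ 64 8 + a₂' ≤ c.δ * ((c.L : ℝ) / 2) * c.κ)
    (hsm229' : c.α₆ * Real.exp a₂' * K₀ 64 8 * 64 ≤ a₂')
    (hR20 : 18 * ((1 - 7 * c.δ) * ((c.L : ℝ) / 2) * c.κ) ≤ (c.κ₁ - 1) / 2)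
    (ha₅ : 0 ≤ a₅) (habs : a₅ + Real.exp (-((c.κ₁ - 1) / 2)) ≤ Aabs)
    (hAc : Aabs * 64 ≤ c.δ * ((c.L : ℝ) / 2) * c.κ)
    (hR17 : Real.exp (-(a / 20)) ≤ c.eps2)
    (hC3 : 2 * ((c.L : ℝ) + 2) ^ 4 * (K₀ 64 8 * Real.exp (Real.exp (-(a / 20)) * 64)) * (c.ε₁ * c.K₀) / c.α₆ *
      Real.exp (Aabs * 64) ≤ 2 * ((c.L : ℝ) + 2) ^ 4 * c.A₁ * c.K₀ * c.ε₁)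
    (hR15' : Ē' * c.ε₁ * c.K₀ * Real.exp (5 * c.κ) ≤ 1)
    (h18half' : ((c.L : ℝ) + 2) ^ 4 * (K₀ 64 8 * Real.exp (Real.exp (-(a / 20)) * 64)) * (Ē' * c.ε₁ * c.K₀) ≤ 1 / 2)
    (h18' : 2 * ((c.L : ℝ) + 2) ^ 4 * (K₀ 64 8 * Real.exp (Real.exp (-(a / 20)) * 64)) * (Ē' * c.ε₁ * c.K₀) *
      Real.exp (5 * ((1 - 7 * c.δ) * ((c.L : ℝ) / 2) * c.κ)) ≤ c.α₆)
    {Cube : Type} [DecidableEq Cube] (G : B13Resummation.Geometry W'.toStepData.Dk1 Cube)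
    (hsp : B13Resummation.SpRestr W'.toStepData G) (hrep : B13Resummation.Repr213 W'.toStepData G)
    (h22 : c.R22) (hlarge : c.κ + 2 * G.κ₀ + 2 ≤ (1 - 8 * c.δ) * ((c.L : ℝ) / 2) * c.κ)
    (hA₂ : Real.exp 1 * G.ν * G.c₁ * G.K₀ ^ 2 ≤ c.A₂)
    (hk' : 0 ≤ 2 * ((c.L : ℝ) + 2) ^ 4 * c.A₁ * c.K₀ * c.ε₁)
    (h23' : c.A₂ * (2 * ((c.L : ℝ) + 2) ^ 4 * c.A₁ * c.K₀ * c.ε₁) ≤ 1 / 2)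
    (hKP' : Ē' * (2 * ((c.L : ℝ) + 2) ^ 4 * c.A₁ * c.K₀ * c.ε₁ * (Real.exp (5 * c.κ + 1) * G.K₀ * G.ν * G.c₁)) ≤ 1) :
    B13.Bound118 W'.toStepData.Dk1 W'.toStepData.sp2 W'.toStepData.Ek1 (Ē' / 2) c.κ := by
  have h238 : B13.Bound238 W'.toStepData (withE₀ c Ē') :=
    bound238_cap_of_termwise c hL hLc hĒ0 hEE hk W' T hH h226 hα₆ hδ hδ7 hκ ha hR16 hR16' h231 ha₂ hκ229 hsm229 habsk
      ha₂' hκ229' hsm229' hR20 ha₅ habs hAc hR17 hC3 hR15' h18half' h18'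
  have h238W := (B13.bound238With_half W'.toStepData (withE₀ c Ē')).2 h238
  have h23c : (withE₀ c Ē').R23 := R23_withE₀_of_scaleFree c hĒ0 h23'
  have hA' : 0 ≤ (withE₀ c Ē').C3act * (withE₀ c Ē').ε₁ := by
    rw [C3eps1_withE₀_eq]; exact mul_nonneg hĒ0 hk'
  have hsmallc : (withE₀ c Ē').C3act * (withE₀ c Ē').ε₁ * Real.exp (5 * (withE₀ c Ē').κ + 1) * G.K₀ * G.ν * G.c₁ ≤ 1 := by
    have : (withE₀ c Ē').C3act * (withE₀ c Ē').ε₁ * Real.exp (5 * (withE₀ c Ē').κ + 1) * G.K₀ * G.ν * G.c₁ =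
        Ē' * (2 * ((c.L : ℝ) + 2) ^ 4 * c.A₁ * c.K₀ * c.ε₁ * (Real.exp (5 * c.κ + 1) * G.K₀ * G.ν * G.c₁)) := by
      rw [C3eps1_withE₀_eq, withE₀_κ]; ring
    rw [this]; exact hKP'
  exact B13Resummation.bound118_of_KP W'.toStepData (withE₀ c Ē') G hsp hrep h238W h22 h23c hA' hκ hlarge hsmallc hA₂

end CapLetters

end

end Summit.QuantumFields.YangMills.Cruxes.Record13SepCoPHInhabited.Lens2G6
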